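import Literature.Geometry.Lorentzian.CoordSigma2Linearization
import Literature.Geometry.Lorentzian.CoordConformalSchoutenLaplacian
import Literature.Geometry.Lorentzian.CoordPairingDerivQuadratic
import Literature.Geometry.Lorentzian.CoordHessianLaplacianCommute
import Literature.Topology.FourManifolds.MorseExtrema
import HarnessLib

/-!
# The Laplacian estimate for the `σ₂`-type conformal equation at a maximum point (coordinates)

Support file for the named fact
`Literature.Geometry.Riemannian.gurskyViaclovsky_hessianEstimate_weighted_four`
(Gursky–Viaclovsky 2003, Prop. 6: the a-priori `C²` bound along the `σ₂`-continuity path, given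
`C⁰` and `C¹` bounds). In the coordinate language of `CoordCurvature.lean` (metric components `G`
on an open `V` of the model space) the path equation reads, for the twisted Schouten-type field
`W = Hess f + df ⊗ df − ½|∇f|²G + B` (`B` a smooth symmetric background field),
`½ (c (tr_G W)² − |W|²_G) = Φ` with `c ≥ 1` and `Φ > 0` smooth. This file carries out S. Chen's
maximum-principle computation (IMRN 2005:63, §3, proof of Thm. 1(a), with the cut-off `η ≡ 1`
and the gradient bound given) at a local maximum `x` of the test function `L = Δf + |∇f|²`:

* `IsMetricOn.contDiffOn_schouten`, `schouten_apply`, `IsMetricOn.schouten_symm` — the field `W`;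
* `IsMetricOn.linearization_cov₂At_eq_fderiv` — the differentiated equation
  `𝔞_W(∇_Y W) = ∂_Y Φ`, `𝔞_W(T) = c tr W tr T − ⟨W,T⟩` the linearised operator;
* `IsMetricOn.lapAt_le_sum_linearization` — the traced concavity inequality
  `ΔΦ ≤ Σ_k(∂_kΦ)²/(2Φ) + Σ_k 𝔞_W(∇²_{e_k,e_k}W)` (Gursky–Viaclovsky's Prop. 1 (iii));
* `IsMetricOn.fderiv_lapAt_of_isLocalMax`, `IsMetricOn.hessAt_apply_self_nonpos_of_isLocalMax` —
  first and second order conditions at the maximum of `L`;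
* `IsMetricOn.cov₂At_hessAt_apply_sharp`, `IsMetricOn.hessAt_lapAt_add_gradSqAt` — `Hess L`
  through `ΔW`, the Ricci identities and Bochner's formula (Chen's "I" and "II");
* **`IsMetricOn.normSqAt_hessAt_le_of_isLocalMax`** (frame-entry form) and
  **`IsMetricOn.normSqAt_hessAt_le_of_isLocalMax_of_norm`** (norm form) — at such a maximum,
  in a `G x`-orthonormal frame with entries of `∇B, ∇²B, Rm, ∇Rm, dΦ` and `|ΔΦ|/(1 + |Δf|)`
  bounded by `K` and
  `|∇f|² ≤ K²`, `Φ ≥ Φ₀ > 0`, `tr_G W > 0`, `1 ≤ c ≤ c₁`: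
  `|Hess f|²_G(x) ≤ C(n, c₁, K, Φ₀)` with an explicit polynomial constant.

On a compact manifold the global maximum of `Δu + |∇u|²` read in a chart gives the Laplacian
bound that `GurskyViaclovskyC2EstimateProofs.hessianEstimate_of_dalembertianEstimate` turns into
the `C²` estimate. Everything is proved; no definition and no named fact is introduced.

## References

* S. Chen, *Local estimates for some fully nonlinear elliptic equations*, Int. Math. Res. Not.
  2005:63, 3937–3955, Thm. 1(a), Cor. 1–2, §3. [Chen2005]
* M. J. Gursky, J. A. Viaclovsky, *A fully nonlinear equation on four-manifolds with positive
  scalar curvature*, J. Differential Geom. 63 (2003) 131–154, §2, Prop. 1 (ii)–(iii); §5,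
  Prop. 6. [GurskyViaclovsky2003]
* B. O'Neill, *Semi-Riemannian geometry*, Academic Press 1983, Ch. 3, pp. 60–61, 85–87.
  [ONeill1983]
-/

noncomputable section

set_option maxSynthPendingDepth 3

open Set Filter ContinuousLinearMap Module Finset
open scoped Topology ContDiff

namespace Literature.Geometry.Lorentzian

namespace MetricCoord

variable {E : Type*} [NormedAddCommGroup E] [NormedSpace ℝ E] [CompleteSpace E]
  [FiniteDimensional ℝ E] {G : E → E →L[ℝ] E →L[ℝ] ℝ} {V : Set E} {x : E} {f : E → ℝ}
  {Bf W : E → E →L[ℝ] E →L[ℝ] ℝ}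


/-! ### Bookkeeping for the functional `t ↦ c w Σ_i t_ii − Σ_{ij} W_{ji} t_ij` on frame arrays -/

section Arrays

variable {ι : Type*} [Fintype ι]

/-- Splitting the functional over a six-term combination of arrays. [folklore] -/
private theorem linComb_expand₆ (cw r s : ℝ) (Wm t a b g d m τ : ι → ι → ℝ)
    (ht : ∀ i j, t i j = a i j - b i j + g i j * r - d i j + m i j + τ i j * s) :
    cw * ∑ i, t i i - ∑ i, ∑ j, Wm j i * t i j =
      (cw * ∑ i, a i i - ∑ i, ∑ j, Wm j i * a i j)
      - (cw * ∑ i, b i i - ∑ i, ∑ j, Wm j i * b i j)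
      + (cw * ∑ i, g i i - ∑ i, ∑ j, Wm j i * g i j) * r
      - (cw * ∑ i, d i i - ∑ i, ∑ j, Wm j i * d i j)
      + (cw * ∑ i, m i i - ∑ i, ∑ j, Wm j i * m i j)
      + (cw * ∑ i, τ i i - ∑ i, ∑ j, Wm j i * τ i j) * s := by
  simp only [ht, mul_add, mul_sub, ← mul_assoc, Finset.sum_add_distrib, Finset.sum_sub_distrib,
    ← Finset.sum_mul]
  ring

/-- Splitting the functional over a five-term combination of arrays. [folklore] -/
private theorem linComb_expand₅ (cw r : ℝ) (Wm t a b g d m : ι → ι → ℝ)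
    (ht : ∀ i j, t i j = a i j - b i j + g i j * r - d i j - m i j) :
    cw * ∑ i, t i i - ∑ i, ∑ j, Wm j i * t i j =
      (cw * ∑ i, a i i - ∑ i, ∑ j, Wm j i * a i j)
      - (cw * ∑ i, b i i - ∑ i, ∑ j, Wm j i * b i j)
      + (cw * ∑ i, g i i - ∑ i, ∑ j, Wm j i * g i j) * r
      - (cw * ∑ i, d i i - ∑ i, ∑ j, Wm j i * d i j)
      - (cw * ∑ i, m i i - ∑ i, ∑ j, Wm j i * m i j) := by
  simp only [ht, mul_add, mul_sub, ← mul_assoc, Finset.sum_add_distrib, Finset.sum_sub_distrib,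
    ← Finset.sum_mul]
  ring

/-- The functional commutes with finite sums of arrays. [folklore] -/
private theorem linComb_sum {κ : Type*} [Fintype κ] (cw : ℝ) (Wm : ι → ι → ℝ)
    (X : κ → ι → ι → ℝ) :
    cw * ∑ i, ∑ k, X k i i - ∑ i, ∑ j, Wm j i * ∑ k, X k i j =
      ∑ k, (cw * ∑ i, X k i i - ∑ i, ∑ j, Wm j i * X k i j) := by
  have h1 : cw * ∑ i, ∑ k, X k i i = ∑ k, cw * ∑ i, X k i i := by
    rw [Finset.sum_comm, Finset.mul_sum]
  have h2 : ∑ i, ∑ j, Wm j i * ∑ k, X k i j = ∑ k, ∑ i, ∑ j, Wm j i * X k i j := by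
    calc ∑ i, ∑ j, Wm j i * ∑ k, X k i j = ∑ i, ∑ j, ∑ k, Wm j i * X k i j := by
          simp only [Finset.mul_sum]
      _ = ∑ i, ∑ k, ∑ j, Wm j i * X k i j :=
          Finset.sum_congr rfl fun i _ ↦ Finset.sum_comm
      _ = ∑ k, ∑ i, ∑ j, Wm j i * X k i j := Finset.sum_comm
  rw [h1, h2, ← Finset.sum_sub_distrib]

/-- **`|c w Σ t_ii − Σ W_ji t_ij| ≤ 2 c w Σ |t_ij|`** when `|W_ij| ≤ c w`. [cite: Chen2005, §3] -/
private theorem abs_linComb_le {cw : ℝ} (hcw : 0 ≤ cw) {Wm : ι → ι → ℝ}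
    (hWm : ∀ i j, |Wm i j| ≤ cw) (t : ι → ι → ℝ) :
    |cw * ∑ i, t i i - ∑ i, ∑ j, Wm j i * t i j| ≤ 2 * cw * ∑ i, ∑ j, |t i j| := by
  have htr : |cw * ∑ i, t i i| ≤ cw * ∑ i, ∑ j, |t i j| := by
    rw [abs_mul, abs_of_nonneg hcw]
    refine mul_le_mul_of_nonneg_left ((Finset.abs_sum_le_sum_abs _ _).trans
      (Finset.sum_le_sum fun i _ ↦ ?_)) hcw
    exact Finset.single_le_sum (f := fun j ↦ |t i j|) (fun _ _ ↦ abs_nonneg _) (Finset.mem_univ i)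
  have hpr : |∑ i, ∑ j, Wm j i * t i j| ≤ cw * ∑ i, ∑ j, |t i j| := by
    rw [Finset.mul_sum]
    refine (Finset.abs_sum_le_sum_abs _ _).trans (Finset.sum_le_sum fun i _ ↦ ?_)
    rw [Finset.mul_sum]
    refine (Finset.abs_sum_le_sum_abs _ _).trans (Finset.sum_le_sum fun j _ ↦ ?_)
    rw [abs_mul]
    exact mul_le_mul_of_nonneg_right (hWm j i) (abs_nonneg _)
  calc |cw * ∑ i, t i i - ∑ i, ∑ j, Wm j i * t i j|
      ≤ |cw * ∑ i, t i i| + |∑ i, ∑ j, Wm j i * t i j| := abs_sub _ _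
    _ ≤ _ := by linarith

/-- `(Σ_{ij} |t_ij|)² ≤ n² Σ_{ij} t_ij²` (Cauchy–Schwarz twice). [folklore] -/
private theorem sq_sum_sum_abs_le (t : ι → ι → ℝ) :
    (∑ i, ∑ j, |t i j|) ^ 2 ≤ (Fintype.card ι : ℝ) ^ 2 * ∑ i, ∑ j, t i j ^ 2 := by
  have h1 : (∑ i, ∑ j, |t i j|) ^ 2 ≤ Fintype.card ι * ∑ i, (∑ j, |t i j|) ^ 2 := by
    have := sq_sum_le_card_mul_sum_sq (s := Finset.univ) (f := fun i ↦ ∑ j, |t i j|)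
    simpa [Finset.card_univ] using this
  have h2 : ∀ i, (∑ j, |t i j|) ^ 2 ≤ Fintype.card ι * ∑ j, t i j ^ 2 := by
    intro i
    have := sq_sum_le_card_mul_sum_sq (s := Finset.univ) (f := fun j ↦ |t i j|)
    simpa [Finset.card_univ, sq_abs] using this
  calc (∑ i, ∑ j, |t i j|) ^ 2 ≤ Fintype.card ι * ∑ i, (∑ j, |t i j|) ^ 2 := h1
    _ ≤ Fintype.card ι * ∑ i, (Fintype.card ι * ∑ j, t i j ^ 2) :=
        mul_le_mul_of_nonneg_left (Finset.sum_le_sum fun i _ ↦ h2 i) (by positivity)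
    _ = (Fintype.card ι : ℝ) ^ 2 * ∑ i, ∑ j, t i j ^ 2 := by rw [← Finset.mul_sum]; ring


/-- `|Σ_m u_m v_m| ≤ a Σ_m |v_m|` when `|u_m| ≤ a`. [folklore] -/
private theorem abs_sum_mul_le {u v : ι → ℝ} {a : ℝ} (hu : ∀ m, |u m| ≤ a) :
    |∑ m, u m * v m| ≤ a * ∑ m, |v m| := by
  rw [Finset.mul_sum]
  refine (Finset.abs_sum_le_sum_abs _ _).trans (Finset.sum_le_sum fun m _ ↦ ?_)
  rw [abs_mul]
  exact mul_le_mul_of_nonneg_right (hu m) (abs_nonneg _)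

/-- `|Σ_m u_m v_m| ≤ b Σ_m |u_m|` when `|v_m| ≤ b`. [folklore] -/
private theorem abs_sum_mul_le' {u v : ι → ℝ} {b : ℝ} (hv : ∀ m, |v m| ≤ b) :
    |∑ m, u m * v m| ≤ b * ∑ m, |u m| := by
  rw [Finset.mul_sum]
  refine (Finset.abs_sum_le_sum_abs _ _).trans (Finset.sum_le_sum fun m _ ↦ ?_)
  rw [abs_mul, mul_comm b]
  exact mul_le_mul_of_nonneg_left (hv m) (abs_nonneg _)

/-- `Σ_m |v_m| ≤ n b` when `|v_m| ≤ b`. [folklore] -/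
private theorem sum_abs_le_card_mul {v : ι → ℝ} {b : ℝ} (hv : ∀ m, |v m| ≤ b) :
    ∑ m, |v m| ≤ Fintype.card ι * b :=
  (Finset.sum_le_sum fun m _ ↦ hv m).trans (by simp [Finset.card_univ])

/-- `Σ_m w_m ≤ n b` when `w_m ≤ b`. [folklore] -/
private theorem sum_le_card_mul {w : ι → ℝ} {b : ℝ} (hw : ∀ m, w m ≤ b) :
    ∑ m, w m ≤ Fintype.card ι * b :=
  (Finset.sum_le_sum fun m _ ↦ hw m).trans (by simp [Finset.card_univ])


/-- The closing real-variable step: `N ≤ P + Q S` and `S² ≤ m² N` give `N ≤ 2P + m² Q²`.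
[folklore] -/
private theorem final_algebra {N S P Q m : ℝ} (hN : 0 ≤ N)
    (h1 : N ≤ P + Q * S) (h2 : S ^ 2 ≤ m ^ 2 * N) : N ≤ 2 * P + m ^ 2 * Q ^ 2 := by
  have hu : (Q * S) ^ 2 ≤ (N / 2 + m ^ 2 * Q ^ 2 / 2) ^ 2 := by
    nlinarith [mul_le_mul_of_nonneg_left h2 (sq_nonneg Q), sq_nonneg (N / 2 - m ^ 2 * Q ^ 2 / 2)]
  have hv : 0 ≤ N / 2 + m ^ 2 * Q ^ 2 / 2 := by positivity
  have h3 := (abs_le_of_sq_le_sq' hu hv).2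
  linarith

end Arrays

/-! ### Smoothness and symmetry of `W` -/

omit [FiniteDimensional ℝ E] in
/-- `W = Hess f + df⊗df − ½|∇f|²G + B` is `C^∞` on `V`. [cite: Chen2005, §3] -/
theorem IsMetricOn.contDiffOn_schouten (hG : IsMetricOn G V) (hf : ContDiffOn ℝ ∞ f V)
    (hB : ContDiffOn ℝ ∞ Bf V) (hW : W = (fun y ↦ hessAt G f y
      + ContinuousLinearMap.smulRightL ℝ E (E →L[ℝ] ℝ) (fderiv ℝ f y) (fderiv ℝ f y)
      - (1 / 2 : ℝ) • (gradSqAt G f y • G y) + Bf y)) : ContDiffOn ℝ ∞ W V := by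
  rw [hW]
  exact (((hG.contDiffOn_hessAt hf).add (contDiffOn_smulRightL_fderiv hG.isOpen hf)).sub
    (fun y hy ↦ (((hG.contDiffOn_gradSqAt hf).smul hG.contDiffOn) y hy).const_smul _)).add hB

omit [CompleteSpace E] [FiniteDimensional ℝ E] in
/-- `W(y)(v, w)` unfolded. [cite: Chen2005, §3] -/
theorem schouten_apply (hW : W = (fun y ↦ hessAt G f y
      + ContinuousLinearMap.smulRightL ℝ E (E →L[ℝ] ℝ) (fderiv ℝ f y) (fderiv ℝ f y)
      - (1 / 2 : ℝ) • (gradSqAt G f y • G y) + Bf y)) (y v w : E) :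
    W y v w = hessAt G f y v w + fderiv ℝ f y v * fderiv ℝ f y w
      - 1 / 2 * gradSqAt G f y * G y v w + Bf y v w := by
  rw [hW]
  simp only [_root_.add_apply, _root_.sub_apply, _root_.smul_apply, smulRightL_fderiv_apply,
    smul_eq_mul, mul_assoc]

omit [CompleteSpace E] [FiniteDimensional ℝ E] in
/-- `W` is symmetric on `V` when `B` is. [cite: Chen2005, §3] -/
theorem IsMetricOn.schouten_symm (hG : IsMetricOn G V) (hf : ContDiffOn ℝ ∞ f V)
    (hBs : ∀ y ∈ V, ∀ v w, Bf y v w = Bf y w v) (hW : W = (fun y ↦ hessAt G f y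
      + ContinuousLinearMap.smulRightL ℝ E (E →L[ℝ] ℝ) (fderiv ℝ f y) (fderiv ℝ f y)
      - (1 / 2 : ℝ) • (gradSqAt G f y • G y) + Bf y)) {y : E} (hy : y ∈ V) (v w : E) :
    W y v w = W y w v := by
  have hfy : ContDiffAt ℝ ∞ f y := (hf y hy).contDiffAt (hG.mem_nhds hy)
  rw [schouten_apply hW, schouten_apply hW, hG.hessAt_comm hy hfy v w, hG.symm y hy v w,
    hBs y hy v w, mul_comm (fderiv ℝ f y v)]

/-! ### The differentiated equation: `𝔞_W(∇_Y W) = ∂_Y Φ` and the traced concavity inequality -/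

/-- **First derivative of the equation `½(c (tr W)² − |W|²) = Φ`**: at a point of `V`,
`c tr W tr(∇_Y W) − ⟨W, ∇_Y W⟩ = ∂_Y Φ` (Chen 2005, §3, the terms `F^{ij} W_{ij,k} = f_k`).
[cite: Chen2005, §3] -/
theorem IsMetricOn.linearization_cov₂At_eq_fderiv (hG : IsMetricOn G V) (hx : x ∈ V)
    (hWc : ContDiffOn ℝ ∞ W V) {Φ : E → ℝ} {c : ℝ}
    (heq : ∀ y ∈ V, 1 / 2 * (c * mtrAt G y (W y) ^ 2 - pairAt G y (W y) (W y)) = Φ y) (Y : E) :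
    c * mtrAt G x (W x) * mtrAt G x (cov₂At G W x Y) - pairAt G x (W x) (cov₂At G W x Y) =
      fderiv ℝ Φ x Y := by
  have hd : DifferentiableAt ℝ W x :=
    ((hWc x hx).contDiffAt (hG.mem_nhds hx)).differentiableAt (by simp)
  rw [← hG.fderiv_quadratic hx hd Y]
  congr 1
  refine Filter.EventuallyEq.fderiv_eq ?_
  filter_upwards [hG.mem_nhds hx] with y hy using heq y hy

variable {ι : Type*} [Fintype ι] [DecidableEq ι]

/-- **The traced concavity inequality for the equation `½(c (tr W)² − |W|²) = Φ > 0`** at a point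
`x` with `G x` positive definite and a `G x`-orthonormal basis `e`, for a symmetric smooth field
`W` (Chen 2005, §3: from `F^{ij} W_{ij,kk} + F^{ij,rs} W_{ij,k} W_{rs,k} = f_{kk}` and the
concavity of `F = (2P)^{1/2}`, `F^{ij}W_{ij,kk} ≥ Δf`; here in the un-rooted form):
`ΔΦ ≤ (Σ_k (∂_k Φ)²)/(2Φ) + Σ_k 𝔞_W(∇²_{e_k,e_k} W)`, by `lapAt_quadratic`,
`sum_quadratic_le_of_cone` and `linearization_cov₂At_eq_fderiv`. [cite: Chen2005, §3]
[cite: GurskyViaclovsky2003, Prop. 1 (iii)] -/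
theorem IsMetricOn.lapAt_le_sum_linearization (hG : IsMetricOn G V) (hx : x ∈ V)
    (hWc : ContDiffOn ℝ ∞ W V) (hWs : ∀ y ∈ V, ∀ v w, W y v w = W y w v) (e : Basis ι ℝ E)
    (he : ∀ i j, G x (e i) (e j) = if i = j then 1 else 0) {Φ : E → ℝ} {c : ℝ} (hc : 0 < c)
    (heq : ∀ y ∈ V, 1 / 2 * (c * mtrAt G y (W y) ^ 2 - pairAt G y (W y) (W y)) = Φ y)
    (hΦ : 0 < Φ x) :
    lapAt G Φ x ≤ (∑ k, fderiv ℝ Φ x (e k) ^ 2) / (2 * Φ x)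
      + ∑ k, (c * mtrAt G x (W x) * mtrAt G x (cov₃At G (cov₂At G W) x (e k) (e k))
        - pairAt G x (W x) (cov₃At G (cov₂At G W) x (e k) (e k))) := by
  have hi : (G x).IsInvertible := hG.isInvertible x hx
  have hs : ∀ v w, G x v w = G x w v := hG.symm x hx
  have hd : DifferentiableAt ℝ W x :=
    ((hWc x hx).contDiffAt (hG.mem_nhds hx)).differentiableAt (by simp)
  -- `lapAt Φ = lapAt (P ∘ W)` near `x`
  have hcongr : lapAt G Φ x =
      lapAt G (fun y ↦ 1 / 2 * (c * mtrAt G y (W y) ^ 2 - pairAt G y (W y) (W y))) x := by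
    refine lapAt_congr_of_eventuallyEq G ?_
    filter_upwards [hG.mem_nhds hx] with y hy using (heq y hy).symm
  rw [hcongr, hG.lapAt_quadratic hx hWc e]
  simp only [ginv_of_orthonormal e he hi, ite_mul, one_mul, zero_mul, Finset.sum_ite_eq,
    Finset.mem_univ, if_true]
  -- the cone condition at `x`: `c (tr W)² − |W|² = 2Φ(x) > 0`
  have hQ : c * mtrAt G x (W x) ^ 2 - normSqAt G x (W x) = 2 * Φ x := by
    rw [← pairAt_self_of_symm G x (hWs x hx), ← heq x hx]
    ring
  have hQpos : 0 < c * mtrAt G x (W x) ^ 2 - normSqAt G x (W x) := by rw [hQ]; positivity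
  -- symmetry of `∇_{e_k} W`
  have hYs : ∀ k (v w : E), cov₂At G W x (e k) v w = cov₂At G W x (e k) w v := by
    intro k v w
    refine cov₂At_symm hd ?_ (e k) v w
    filter_upwards [hG.mem_nhds hx] with y hy using hWs y hy
  have h1 : ∑ k, (c * mtrAt G x (cov₂At G W x (e k)) * mtrAt G x (cov₂At G W x (e k))
      - pairAt G x (cov₂At G W x (e k)) (cov₂At G W x (e k))) =
      ∑ k, (c * mtrAt G x (cov₂At G W x (e k)) ^ 2 - normSqAt G x (cov₂At G W x (e k))) :=
    Finset.sum_congr rfl fun k _ ↦ by rw [pairAt_self_of_symm G x (hYs k), sq, mul_assoc]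
  have h2 := sum_quadratic_le_of_cone e he hi hs (hWs x hx) hc hQpos Finset.univ
    (fun k ↦ cov₂At G W x (e k))
  have h3 : ∑ k, (c * mtrAt G x (W x) * mtrAt G x (cov₂At G W x (e k))
      - pairAt G x (W x) (cov₂At G W x (e k))) ^ 2 = ∑ k, fderiv ℝ Φ x (e k) ^ 2 :=
    Finset.sum_congr rfl fun k _ ↦ by rw [hG.linearization_cov₂At_eq_fderiv hx hWc heq (e k)]
  rw [h3, hQ] at h2
  rw [h1]
  linarith


/-! ### `Hess L` through `ΔW`: the commuted and expanded second derivatives -/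

omit [FiniteDimensional ℝ E] in
/-- **Codazzi shift of `(∇_B Hess f)(C, ♯df)`** (Chen 2005, §3, the treatment of "II": `u_{ijk}`
through `W_{ij,k}`): with `Z = ♯df`,
`(∇_B Hess f)(C, Z) = (∇_Z W)(B,C) − [Hess f(Z,B)df(C) + df(B)Hess f(Z,C)] + Hess f(Z,Z) G(B,C)
 − (∇_Z B)(B,C) − df(R(B,Z)C)` (symmetry of `∇Hess f` in its last slots, the Ricci identity
`cov₂At_hessAt_comm`, and `cov₂At_schouten`). [cite: Chen2005, §3] -/
theorem IsMetricOn.cov₂At_hessAt_apply_sharp (hG : IsMetricOn G V) (hx : x ∈ V)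
    (hf : ContDiffOn ℝ ∞ f V) (hB : ContDiffOn ℝ ∞ Bf V) (hW : W = (fun y ↦ hessAt G f y
      + ContinuousLinearMap.smulRightL ℝ E (E →L[ℝ] ℝ) (fderiv ℝ f y) (fderiv ℝ f y)
      - (1 / 2 : ℝ) • (gradSqAt G f y • G y) + Bf y)) (B C : E) :
    cov₂At G (hessAt G f) x B C (sharpAt G x (fderiv ℝ f x)) =
      cov₂At G W x (sharpAt G x (fderiv ℝ f x)) B C
      - (hessAt G f x (sharpAt G x (fderiv ℝ f x)) B * fderiv ℝ f x C
          + fderiv ℝ f x B * hessAt G f x (sharpAt G x (fderiv ℝ f x)) C)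
      + hessAt G f x (sharpAt G x (fderiv ℝ f x)) (sharpAt G x (fderiv ℝ f x)) * G x B C
      - cov₂At G Bf x (sharpAt G x (fderiv ℝ f x)) B C
      - fderiv ℝ f x (riemAt G x B (sharpAt G x (fderiv ℝ f x)) C) := by
  set Z := sharpAt G x (fderiv ℝ f x) with hZ
  have hd : DifferentiableAt ℝ (hessAt G f) x :=
    (((hG.contDiffOn_hessAt hf) x hx).contDiffAt (hG.mem_nhds hx)).differentiableAt (by simp)
  have hτs : cov₂At G (hessAt G f) x B C Z = cov₂At G (hessAt G f) x B Z C := by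
    refine cov₂At_symm hd ?_ B C Z
    filter_upwards [hG.mem_nhds hx] with y hy
    exact hG.hessAt_comm hy ((hf y hy).contDiffAt (hG.mem_nhds hy))
  have hcod := hG.cov₂At_hessAt_comm hx hf B Z C
  have hsch := hG.cov₂At_schouten hx hf hB Z B C
  rw [← hW] at hsch
  linarith [hτs, hcod, hsch]

/-- **`Hess L` for `L = Δf + |∇f|²` through `ΔW`** in a `G x`-orthonormal basis `e` (Chen 2005,
§3: `L_{ij} = u_{kkij} + 2u_{ki}u_{kj} + 2u_k u_{kij}`, the commutation `u_{kkij} = u_{ijkk} + Rm ∗ ∇²u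
 + ∇Rm ∗ ∇u`, and `u_{ijkk} = W_{ij,kk} − …`; the two `∇²u ∗ ∇²u` terms cancel because `a = 1`):
with `Z = ♯df`, `θ = dΔf + Ric(Z, ·)`,
`Hess L(B,C) = Σ_k (∇²_{e_k,e_k} W)(B,C) − [θ(B)df(C) + df(B)θ(C)] + ½ Δ|∇f|² G(B,C)
 − Σ_k (∇²_{e_k,e_k} B)(B,C) + Σ_k Comm_k(B,C) + 2 (∇_B Hess f)(C, Z)`,
`Comm_k` the curvature terms of `lap_hessAt_sub_hessAt_lapAt`. [cite: Chen2005, §3] -/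
theorem IsMetricOn.hessAt_lapAt_add_gradSqAt (hG : IsMetricOn G V) (hx : x ∈ V)
    (hf : ContDiffOn ℝ ∞ f V) (hB : ContDiffOn ℝ ∞ Bf V) (hW : W = (fun y ↦ hessAt G f y
      + ContinuousLinearMap.smulRightL ℝ E (E →L[ℝ] ℝ) (fderiv ℝ f y) (fderiv ℝ f y)
      - (1 / 2 : ℝ) • (gradSqAt G f y • G y) + Bf y)) (e : Basis ι ℝ E)
    (he : ∀ i j, G x (e i) (e j) = if i = j then 1 else 0) (B C : E) :
    hessAt G (fun y ↦ lapAt G f y + gradSqAt G f y) x B C =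
      ∑ k, cov₃At G (cov₂At G W) x (e k) (e k) B C
      - ((fderiv ℝ (lapAt G f) x B + ricAt G x (sharpAt G x (fderiv ℝ f x)) B) * fderiv ℝ f x C
          + fderiv ℝ f x B
            * (fderiv ℝ (lapAt G f) x C + ricAt G x (sharpAt G x (fderiv ℝ f x)) C))
      + 1 / 2 * (lapAt G (gradSqAt G f) x * G x B C)
      - ∑ k, cov₃At G (cov₂At G Bf) x (e k) (e k) B C
      + ∑ k, ((hessAt G f x B (riemAt G x (e k) C (e k))
            + fderiv ℝ f x (covRiemAt G x B (e k) C (e k)))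
          + (hessAt G f x (e k) (riemAt G x (e k) B C)
            + fderiv ℝ f x (covRiemAt G x (e k) (e k) B C))
          + hessAt G f x (riemAt G x (e k) B (e k)) C
          + hessAt G f x (e k) (riemAt G x (e k) B C))
      + 2 * cov₂At G (hessAt G f) x B C (sharpAt G x (fderiv ℝ f x)) := by
  have hi : (G x).IsInvertible := hG.isInvertible x hx
  have hs : ∀ v w, G x v w = G x w v := hG.symm x hx
  have hfx : ContDiffAt ℝ ∞ f x := (hf x hx).contDiffAt (hG.mem_nhds hx)
  have c1 : ContDiffAt ℝ 2 (lapAt G f) x :=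
    (((hG.contDiffOn_lapAt hf) x hx).contDiffAt (hG.mem_nhds hx)).of_le (by norm_cast)
  have c2 : ContDiffAt ℝ 2 (gradSqAt G f) x :=
    (((hG.contDiffOn_gradSqAt hf) x hx).contDiffAt (hG.mem_nhds hx)).of_le (by norm_cast)
  rw [hessAt_add G c1 c2, _root_.add_apply, _root_.add_apply]
  have h1 := hG.lap_hessAt_sub_hessAt_lapAt e hx hf B C
  have h2 := hG.lap_schouten e hx hf hB B C
  rw [← hW] at h2
  simp only [ginv_of_orthonormal e he hi, ite_mul, one_mul, zero_mul, Finset.sum_ite_eq,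
    Finset.mem_univ, if_true] at h1 h2
  have h3 := hG.hessAt_gradSqAt hx hf B C
  have h4 : hessAt G f x C (sharpAt G x (hessAt G f x B)) =
      ∑ k, hessAt G f x B (e k) * hessAt G f x C (e k) :=
    apply_sharpAt_eq_sum_frame e he hi hs (hessAt G f x C) (hessAt G f x B)
  have hHH : ∑ k, (hessAt G f x (e k) B * hessAt G f x (e k) C
      + hessAt G f x (e k) B * hessAt G f x (e k) C) =
      2 * ∑ k, hessAt G f x B (e k) * hessAt G f x C (e k) := by
    rw [Finset.mul_sum]
    refine Finset.sum_congr rfl fun k _ ↦ ?_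
    rw [hG.hessAt_comm hx hfx (e k) B, hG.hessAt_comm hx hfx (e k) C]
    ring
  linarith [h1, h2, h3, h4, hHH]

/-! ### The test function `L = Δf + |∇f|²` at a local maximum -/

omit [DecidableEq ι] [Fintype ι] in
/-- **First-order condition** at a local maximum of `L = Δf + |∇f|²`:
`∂_Y Δf = −2 Hess f(Y, ♯df)` (Chen 2005, §3, (3.2) with `a = 1`, `η ≡ 1`). [cite: Chen2005, §3] -/
theorem IsMetricOn.fderiv_lapAt_of_isLocalMax (hG : IsMetricOn G V) (hx : x ∈ V)
    (hf : ContDiffOn ℝ ∞ f V) (hmax : IsLocalMax (fun y ↦ lapAt G f y + gradSqAt G f y) x)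
    (Y : E) :
    fderiv ℝ (lapAt G f) x Y = -(2 * hessAt G f x Y (sharpAt G x (fderiv ℝ f x))) := by
  have h0 := hmax.fderiv_eq_zero
  have d1 : DifferentiableAt ℝ (lapAt G f) x :=
    (((hG.contDiffOn_lapAt hf) x hx).contDiffAt (hG.mem_nhds hx)).differentiableAt (by simp)
  have d2 : DifferentiableAt ℝ (gradSqAt G f) x :=
    (((hG.contDiffOn_gradSqAt hf) x hx).contDiffAt (hG.mem_nhds hx)).differentiableAt (by simp)
  rw [fderiv_fun_add d1 d2] at h0
  have h1 := congrArg (fun φ : E →L[ℝ] ℝ ↦ φ Y) h0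
  simp only [_root_.add_apply, _root_.zero_apply, hG.fderiv_gradSqAt hx hf] at h1
  linarith

omit [DecidableEq ι] [Fintype ι] in
/-- **Second-order condition** at a local maximum of `L = Δf + |∇f|²`: `Hess L(v, v) ≤ 0`
(`Hess L = D²L` at a critical point). [cite: Chen2005, §3] -/
theorem IsMetricOn.hessAt_apply_self_nonpos_of_isLocalMax (hG : IsMetricOn G V) (hx : x ∈ V)
    (hf : ContDiffOn ℝ ∞ f V) (hmax : IsLocalMax (fun y ↦ lapAt G f y + gradSqAt G f y) x)
    (v : E) :
    hessAt G (fun y ↦ lapAt G f y + gradSqAt G f y) x v v ≤ 0 := by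
  have hL : ContDiffAt ℝ 2 (fun y ↦ lapAt G f y + gradSqAt G f y) x :=
    ((((hG.contDiffOn_lapAt hf).add (hG.contDiffOn_gradSqAt hf)) x hx).contDiffAt
      (hG.mem_nhds hx)).of_le (by norm_cast)
  rw [hessAt_apply, hmax.fderiv_eq_zero, _root_.zero_apply, sub_zero]
  exact Literature.Topology.FourManifolds.IsLocalMax.fderiv_fderiv_apply_self_nonpos hL hmax v


/-! ### The estimate at a maximum point of `Δf + |∇f|²` -/

set_option maxHeartbeats 4000000 in
/-- **The Laplacian estimate for the `σ₂`-type equation at a maximum point of `L = Δf + |∇f|²`,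
frame-entry form** (Chen 2005, Thm. 1(a), §3 with `η ≡ 1`, the gradient bound being given; the
`C²` step of Gursky–Viaclovsky 2003, Prop. 6). Setting: metric components `G` on `V`, a point
`x ∈ V` with `G x` positive definite and a `G x`-orthonormal basis `e`, `n = card ι ≥ 2`; a smooth
`f` and a smooth symmetric `B` with `W = Hess f + df⊗df − ½|∇f|²G + B` satisfying
`½(c (tr_G W)² − |W|²_G) = Φ` on `V` (`1 ≤ c ≤ c₁`), `Φ(x) ≥ Φ₀ > 0`, `tr_G W(x) > 0`, and `x` a
local maximum of `Δf + |∇f|²`. If the frame entries at `x` of `∇B, ∇²B, Rm, ∇Rm, dΦ` and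
`|ΔΦ(x)|/(1 + |Δf(x)|)` are bounded by `K ≥ 1` and `|∇f|²(x) ≤ K²`, then `|Hess f|²_G(x)` is bounded by an
explicit constant `C(n, c₁, K, Φ₀)`. Proof: `0 ≥ 𝔞_W(Hess L)` (ellipticity,
`linearization_nonpos`); `Hess L` through `ΔW` (`hessAt_lapAt_add_gradSqAt`,
`cov₂At_hessAt_apply_sharp`); `𝔞_W(ΔW) ≥ ΔΦ − |dΦ|²/(2Φ)` (concavity,
`lapAt_le_sum_linearization`), `𝔞_W(∇_Z W) = dΦ(Z)`, `𝔞_W(G) = (cn − 1) tr W`; the first-order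
condition `dΔf = −2 Hess f(·, ♯df)` and Bochner's formula for `Δ|∇f|²` produce the good term
`(cn − 1) tr W |Hess f|²`, against junk of lower order controlled by `|W_ij| ≤ c tr W`.
[cite: Chen2005, Thm. 1(a), §3] [cite: GurskyViaclovsky2003, Prop. 6] -/
theorem IsMetricOn.normSqAt_hessAt_le_of_isLocalMax (hG : IsMetricOn G V) (hx : x ∈ V)
    (hf : ContDiffOn ℝ ∞ f V) (hB : ContDiffOn ℝ ∞ Bf V)
    (hBs : ∀ y ∈ V, ∀ v w, Bf y v w = Bf y w v) (hW : W = (fun y ↦ hessAt G f y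
      + ContinuousLinearMap.smulRightL ℝ E (E →L[ℝ] ℝ) (fderiv ℝ f y) (fderiv ℝ f y)
      - (1 / 2 : ℝ) • (gradSqAt G f y • G y) + Bf y))
    (hpos : ∀ v, v ≠ 0 → 0 < G x v v) (e : Basis ι ℝ E)
    (he : ∀ i j, G x (e i) (e j) = if i = j then 1 else 0) {Φ : E → ℝ} {c c₁ K Φ₀ : ℝ}
    (hc : 1 ≤ c) (hc₁ : c ≤ c₁)
    (heq : ∀ y ∈ V, 1 / 2 * (c * mtrAt G y (W y) ^ 2 - pairAt G y (W y) (W y)) = Φ y)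
    (hΦ₀ : 0 < Φ₀) (hΦ : Φ₀ ≤ Φ x) (hw : 0 < mtrAt G x (W x))
    (hmax : IsLocalMax (fun y ↦ lapAt G f y + gradSqAt G f y) x)
    (hn : 2 ≤ Fintype.card ι) (hK : 1 ≤ K) (hγ : gradSqAt G f x ≤ K ^ 2)
    (hKB1 : ∀ a b c', |cov₂At G Bf x (e a) (e b) (e c')| ≤ K)
    (hKB2 : ∀ a b c' d', |cov₃At G (cov₂At G Bf) x (e a) (e b) (e c') (e d')| ≤ K)
    (hKR : ∀ a b c' d', |G x (riemAt G x (e a) (e b) (e c')) (e d')| ≤ K)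
    (hKDR : ∀ a b c' d' m, |G x (covRiemAt G x (e a) (e b) (e c') (e d')) (e m)| ≤ K)
    (hKΦ1 : ∀ a, |fderiv ℝ Φ x (e a)| ≤ K) (hKΦ2 : |lapAt G Φ x| ≤ K * (1 + |lapAt G f x|)) :
    normSqAt G x (hessAt G f x) ≤
      2 * ((K + (Fintype.card ι : ℝ) * K ^ 2 / (2 * Φ₀) + 2 * (Fintype.card ι : ℝ) * K ^ 2) * ((1 + c₁ / (2 * Φ₀)) / 2) + 19 * c₁ * (Fintype.card ι : ℝ) ^ 4 * K ^ 3)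
      + (Fintype.card ι : ℝ) ^ 2 * (K * ((1 + c₁ / (2 * Φ₀)) / 2) + 24 * c₁ * (Fintype.card ι : ℝ) ^ 3 * K ^ 2) ^ 2 := by
  have hi : (G x).IsInvertible := hG.isInvertible x hx
  have hs : ∀ v w, G x v w = G x w v := hG.symm x hx
  have hfx : ContDiffAt ℝ ∞ f x := (hf x hx).contDiffAt (hG.mem_nhds hx)
  have hc0 : 0 < c := by linarith only [hc]
  have hWc : ContDiffOn ℝ ∞ W V := hG.contDiffOn_schouten hf hB hW
  have hWs : ∀ y ∈ V, ∀ v w, W y v w = W y w v := fun y hy ↦ hG.schouten_symm hf hBs hW hy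
  -- the cone condition at `x`
  have hQ : c * mtrAt G x (W x) ^ 2 - normSqAt G x (W x) = 2 * Φ x := by
    rw [← pairAt_self_of_symm G x (hWs x hx), ← heq x hx]
    ring
  have hΦx : 0 < Φ x := lt_of_lt_of_le hΦ₀ hΦ
  have hcone : normSqAt G x (W x) < c * mtrAt G x (W x) ^ 2 := by linarith only [hQ, hΦx]
  -- Step 1: ellipticity `𝔞_W(Hess L) ≤ 0`, in the frame
  have hLc : ContDiffAt ℝ ∞ (fun y ↦ lapAt G f y + gradSqAt G f y) x :=
    (((hG.contDiffOn_lapAt hf).add (hG.contDiffOn_gradSqAt hf)) x hx).contDiffAt (hG.mem_nhds hx)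
  have hLs : ∀ v w, hessAt G (fun y ↦ lapAt G f y + gradSqAt G f y) x v w = hessAt G (fun y ↦ lapAt G f y + gradSqAt G f y) x w v := hG.hessAt_comm hx hLc
  have hA0 := linearization_nonpos hs hpos hLs
    (hG.hessAt_apply_self_nonpos_of_isLocalMax hx hf hmax) hc hw hcone
  rw [mtrAt_eq_sum_frame e he hi (hessAt G (fun y ↦ lapAt G f y + gradSqAt G f y) x), pairAt_eq_sum_frame e he hi hs (W x) (hessAt G (fun y ↦ lapAt G f y + gradSqAt G f y) x)] at hA0
  -- Step 2: `Hess L` expanded, and the functional split over the expansion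
  have hT : ∀ i j, hessAt G (fun y ↦ lapAt G f y + gradSqAt G f y) x (e i) (e j) =
      (∑ k, cov₃At G (cov₂At G W) x (e k) (e k) (e i) (e j)) - ((fderiv ℝ (lapAt G f) x (e i) + ricAt G x (sharpAt G x (fderiv ℝ f x)) (e i)) * fderiv ℝ f x (e j) + fderiv ℝ f x (e i) * (fderiv ℝ (lapAt G f) x (e j) + ricAt G x (sharpAt G x (fderiv ℝ f x)) (e j))) + (G x (e i) (e j)) * (1 / 2 * lapAt G (gradSqAt G f) x) - (∑ k, cov₃At G (cov₂At G Bf) x (e k) (e k) (e i) (e j)) + (∑ k, ((hessAt G f x (e i) (riemAt G x (e k) (e j) (e k)) + fderiv ℝ f x (covRiemAt G x (e i) (e k) (e j) (e k))) + (hessAt G f x (e k) (riemAt G x (e k) (e i) (e j)) + fderiv ℝ f x (covRiemAt G x (e k) (e k) (e i) (e j))) + hessAt G f x (riemAt G x (e k) (e i) (e k)) (e j) + hessAt G f x (e k) (riemAt G x (e k) (e i) (e j)))) + (cov₂At G (hessAt G f) x (e i) (e j) (sharpAt G x (fderiv ℝ f x))) * 2 := by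
    intro i j
    rw [hG.hessAt_lapAt_add_gradSqAt hx hf hB hW e he (e i) (e j)]
    ring
  have hexp : c * mtrAt G x (W x) * ∑ i, hessAt G (fun y ↦ lapAt G f y + gradSqAt G f y) x (e i) (e i) - ∑ i, ∑ j, W x (e j) (e i) * hessAt G (fun y ↦ lapAt G f y + gradSqAt G f y) x (e i) (e j) =
      (c * mtrAt G x (W x) * ∑ i, (∑ k, cov₃At G (cov₂At G W) x (e k) (e k) (e i) (e i)) - ∑ i, ∑ j, W x (e j) (e i) * (∑ k, cov₃At G (cov₂At G W) x (e k) (e k) (e i) (e j)))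
      - (c * mtrAt G x (W x) * ∑ i, (((fderiv ℝ (lapAt G f) x (e i) + ricAt G x (sharpAt G x (fderiv ℝ f x)) (e i)) * fderiv ℝ f x (e i) + fderiv ℝ f x (e i) * (fderiv ℝ (lapAt G f) x (e i) + ricAt G x (sharpAt G x (fderiv ℝ f x)) (e i)))) - ∑ i, ∑ j, W x (e j) (e i) * (((fderiv ℝ (lapAt G f) x (e i) + ricAt G x (sharpAt G x (fderiv ℝ f x)) (e i)) * fderiv ℝ f x (e j) + fderiv ℝ f x (e i) * (fderiv ℝ (lapAt G f) x (e j) + ricAt G x (sharpAt G x (fderiv ℝ f x)) (e j)))))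
      + (c * mtrAt G x (W x) * ∑ i, (G x (e i) (e i)) - ∑ i, ∑ j, W x (e j) (e i) * (G x (e i) (e j))) * (1 / 2 * lapAt G (gradSqAt G f) x)
      - (c * mtrAt G x (W x) * ∑ i, (∑ k, cov₃At G (cov₂At G Bf) x (e k) (e k) (e i) (e i)) - ∑ i, ∑ j, W x (e j) (e i) * (∑ k, cov₃At G (cov₂At G Bf) x (e k) (e k) (e i) (e j)))
      + (c * mtrAt G x (W x) * ∑ i, (∑ k, ((hessAt G f x (e i) (riemAt G x (e k) (e i) (e k)) + fderiv ℝ f x (covRiemAt G x (e i) (e k) (e i) (e k))) + (hessAt G f x (e k) (riemAt G x (e k) (e i) (e i)) + fderiv ℝ f x (covRiemAt G x (e k) (e k) (e i) (e i))) + hessAt G f x (riemAt G x (e k) (e i) (e k)) (e i) + hessAt G f x (e k) (riemAt G x (e k) (e i) (e i)))) - ∑ i, ∑ j, W x (e j) (e i) * (∑ k, ((hessAt G f x (e i) (riemAt G x (e k) (e j) (e k)) + fderiv ℝ f x (covRiemAt G x (e i) (e k) (e j) (e k))) + (hessAt G f x (e k) (riemAt G x (e k) (e i) (e j)) + fderiv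 ℝ f x (covRiemAt G x (e k) (e k) (e i) (e j))) + hessAt G f x (riemAt G x (e k) (e i) (e k)) (e j) + hessAt G f x (e k) (riemAt G x (e k) (e i) (e j)))))
      + (c * mtrAt G x (W x) * ∑ i, (cov₂At G (hessAt G f) x (e i) (e i) (sharpAt G x (fderiv ℝ f x))) - ∑ i, ∑ j, W x (e j) (e i) * (cov₂At G (hessAt G f) x (e i) (e j) (sharpAt G x (fderiv ℝ f x)))) * 2 :=
    linComb_expand₆ (c * mtrAt G x (W x)) (1 / 2 * lapAt G (gradSqAt G f) x) 2 (fun i j ↦ W x (e i) (e j))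
      (fun i j ↦ hessAt G (fun y ↦ lapAt G f y + gradSqAt G f y) x (e i) (e j)) (fun i j ↦ ∑ k, cov₃At G (cov₂At G W) x (e k) (e k) (e i) (e j)) (fun i j ↦ ((fderiv ℝ (lapAt G f) x (e i) + ricAt G x (sharpAt G x (fderiv ℝ f x)) (e i)) * fderiv ℝ f x (e j) + fderiv ℝ f x (e i) * (fderiv ℝ (lapAt G f) x (e j) + ricAt G x (sharpAt G x (fderiv ℝ f x)) (e j)))) (fun i j ↦ G x (e i) (e j))
      (fun i j ↦ ∑ k, cov₃At G (cov₂At G Bf) x (e k) (e k) (e i) (e j)) (fun i j ↦ ∑ k, ((hessAt G f x (e i) (riemAt G x (e k) (e j) (e k)) + fderiv ℝ f x (covRiemAt G x (e i) (e k) (e j) (e k))) + (hessAt G f x (e k) (riemAt G x (e k) (e i) (e j)) + fderiv ℝ f x (covRiemAt G x (e k) (e k) (e i) (e j))) + hessAt G f x (riemAt G x (e k) (e i) (e k)) (e j) + hessAt G f x (e k) (riemAt G x (e k) (e i) (e j)))) (fun i j ↦ cov₂At G (hessAt G f) x (e i) (e j) (sharpAt G x (fderiv ℝ f x))) hT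
  -- Step 3: the `τ`-array `(∇_{e_i} Hess f)(e_j, Z)` expanded (Codazzi shift)
  have hT2 : ∀ i j, cov₂At G (hessAt G f) x (e i) (e j) (sharpAt G x (fderiv ℝ f x)) = cov₂At G W x (sharpAt G x (fderiv ℝ f x)) (e i) (e j) - (hessAt G f x (sharpAt G x (fderiv ℝ f x)) (e i) * fderiv ℝ f x (e j) + fderiv ℝ f x (e i) * hessAt G f x (sharpAt G x (fderiv ℝ f x)) (e j)) + (G x (e i) (e j)) * hessAt G f x (sharpAt G x (fderiv ℝ f x)) (sharpAt G x (fderiv ℝ f x)) - cov₂At G Bf x (sharpAt G x (fderiv ℝ f x)) (e i) (e j) - fderiv ℝ f x (riemAt G x (e i) (sharpAt G x (fderiv ℝ f x)) (e j)) := by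
    intro i j
    rw [hG.cov₂At_hessAt_apply_sharp hx hf hB hW (e i) (e j)]
    ring
  have hexp2 : (c * mtrAt G x (W x) * ∑ i, (cov₂At G (hessAt G f) x (e i) (e i) (sharpAt G x (fderiv ℝ f x))) - ∑ i, ∑ j, W x (e j) (e i) * (cov₂At G (hessAt G f) x (e i) (e j) (sharpAt G x (fderiv ℝ f x)))) =
      (c * mtrAt G x (W x) * ∑ i, (cov₂At G W x (sharpAt G x (fderiv ℝ f x)) (e i) (e i)) - ∑ i, ∑ j, W x (e j) (e i) * (cov₂At G W x (sharpAt G x (fderiv ℝ f x)) (e i) (e j)))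
      - (c * mtrAt G x (W x) * ∑ i, ((hessAt G f x (sharpAt G x (fderiv ℝ f x)) (e i) * fderiv ℝ f x (e i) + fderiv ℝ f x (e i) * hessAt G f x (sharpAt G x (fderiv ℝ f x)) (e i))) - ∑ i, ∑ j, W x (e j) (e i) * ((hessAt G f x (sharpAt G x (fderiv ℝ f x)) (e i) * fderiv ℝ f x (e j) + fderiv ℝ f x (e i) * hessAt G f x (sharpAt G x (fderiv ℝ f x)) (e j))))
      + (c * mtrAt G x (W x) * ∑ i, (G x (e i) (e i)) - ∑ i, ∑ j, W x (e j) (e i) * (G x (e i) (e j))) * hessAt G f x (sharpAt G x (fderiv ℝ f x)) (sharpAt G x (fderiv ℝ f x))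
      - (c * mtrAt G x (W x) * ∑ i, (cov₂At G Bf x (sharpAt G x (fderiv ℝ f x)) (e i) (e i)) - ∑ i, ∑ j, W x (e j) (e i) * (cov₂At G Bf x (sharpAt G x (fderiv ℝ f x)) (e i) (e j)))
      - (c * mtrAt G x (W x) * ∑ i, (fderiv ℝ f x (riemAt G x (e i) (sharpAt G x (fderiv ℝ f x)) (e i))) - ∑ i, ∑ j, W x (e j) (e i) * (fderiv ℝ f x (riemAt G x (e i) (sharpAt G x (fderiv ℝ f x)) (e j)))) :=
    linComb_expand₅ (c * mtrAt G x (W x)) (hessAt G f x (sharpAt G x (fderiv ℝ f x)) (sharpAt G x (fderiv ℝ f x))) (fun i j ↦ W x (e i) (e j))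
      (fun i j ↦ cov₂At G (hessAt G f) x (e i) (e j) (sharpAt G x (fderiv ℝ f x))) (fun i j ↦ cov₂At G W x (sharpAt G x (fderiv ℝ f x)) (e i) (e j)) (fun i j ↦ (hessAt G f x (sharpAt G x (fderiv ℝ f x)) (e i) * fderiv ℝ f x (e j) + fderiv ℝ f x (e i) * hessAt G f x (sharpAt G x (fderiv ℝ f x)) (e j))) (fun i j ↦ G x (e i) (e j))
      (fun i j ↦ cov₂At G Bf x (sharpAt G x (fderiv ℝ f x)) (e i) (e j)) (fun i j ↦ fderiv ℝ f x (riemAt G x (e i) (sharpAt G x (fderiv ℝ f x)) (e j))) hT2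
  -- Step 4: the structural evaluations `𝔞(ΔW) ≥ ΔΦ − |dΦ|²/2Φ`, `𝔞(∇_Z W) = dΦ(Z)`, `𝔞(G) = (cn−1) tr W`
  have ha : (c * mtrAt G x (W x) * ∑ i, (∑ k, cov₃At G (cov₂At G W) x (e k) (e k) (e i) (e i)) - ∑ i, ∑ j, W x (e j) (e i) * (∑ k, cov₃At G (cov₂At G W) x (e k) (e k) (e i) (e j))) =
      ∑ k, (c * mtrAt G x (W x) * mtrAt G x (cov₃At G (cov₂At G W) x (e k) (e k))
        - pairAt G x (W x) (cov₃At G (cov₂At G W) x (e k) (e k))) := by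
    have hsum := linComb_sum (c * mtrAt G x (W x)) (fun i j ↦ W x (e i) (e j))
      (fun k i j ↦ cov₃At G (cov₂At G W) x (e k) (e k) (e i) (e j))
    beta_reduce at hsum
    rw [hsum]
    refine Finset.sum_congr rfl fun k _ ↦ ?_
    rw [mtrAt_eq_sum_frame e he hi (cov₃At G (cov₂At G W) x (e k) (e k)),
      pairAt_eq_sum_frame e he hi hs (W x) (cov₃At G (cov₂At G W) x (e k) (e k))]
  have hD2 := hG.lapAt_le_sum_linearization hx hWc hWs e he hc0 heq hΦx
  rw [← ha] at hD2
  have hD1 : (c * mtrAt G x (W x) * ∑ i, (cov₂At G W x (sharpAt G x (fderiv ℝ f x)) (e i) (e i)) - ∑ i, ∑ j, W x (e j) (e i) * (cov₂At G W x (sharpAt G x (fderiv ℝ f x)) (e i) (e j))) = fderiv ℝ Φ x (sharpAt G x (fderiv ℝ f x)) := by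
    rw [← hG.linearization_cov₂At_eq_fderiv hx hWc heq (sharpAt G x (fderiv ℝ f x)),
      mtrAt_eq_sum_frame e he hi (cov₂At G W x (sharpAt G x (fderiv ℝ f x))),
      pairAt_eq_sum_frame e he hi hs (W x) (cov₂At G W x (sharpAt G x (fderiv ℝ f x)))]
  have hg : (c * mtrAt G x (W x) * ∑ i, (G x (e i) (e i)) - ∑ i, ∑ j, W x (e j) (e i) * (G x (e i) (e j))) = (c * (Fintype.card ι : ℝ) - 1) * mtrAt G x (W x) := by
    rw [← linearization_metric e he hi c (W x), mtrAt_eq_sum_frame e he hi (G x),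
      pairAt_eq_sum_frame e he hi hs (W x) (G x)]
  -- Step 5: Bochner's formula and the first-order condition
  have hΔγ := hG.lapAt_gradSqAt hx hf
  have hcritZ := hG.fderiv_lapAt_of_isLocalMax hx hf hmax (sharpAt G x (fderiv ℝ f x))
  -- the main identity before estimating the junk terms
  have hEq : c * mtrAt G x (W x) * ∑ i, hessAt G (fun y ↦ lapAt G f y + gradSqAt G f y) x (e i) (e i) - ∑ i, ∑ j, W x (e j) (e i) * hessAt G (fun y ↦ lapAt G f y + gradSqAt G f y) x (e i) (e j) =
      (c * mtrAt G x (W x) * ∑ i, (∑ k, cov₃At G (cov₂At G W) x (e k) (e k) (e i) (e i)) - ∑ i, ∑ j, W x (e j) (e i) * (∑ k, cov₃At G (cov₂At G W) x (e k) (e k) (e i) (e j)))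
      - (c * mtrAt G x (W x) * ∑ i, (((fderiv ℝ (lapAt G f) x (e i) + ricAt G x (sharpAt G x (fderiv ℝ f x)) (e i)) * fderiv ℝ f x (e i) + fderiv ℝ f x (e i) * (fderiv ℝ (lapAt G f) x (e i) + ricAt G x (sharpAt G x (fderiv ℝ f x)) (e i)))) - ∑ i, ∑ j, W x (e j) (e i) * (((fderiv ℝ (lapAt G f) x (e i) + ricAt G x (sharpAt G x (fderiv ℝ f x)) (e i)) * fderiv ℝ f x (e j) + fderiv ℝ f x (e i) * (fderiv ℝ (lapAt G f) x (e j) + ricAt G x (sharpAt G x (fderiv ℝ f x)) (e j)))))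
      + ((c * (Fintype.card ι : ℝ) - 1) * mtrAt G x (W x)) * normSqAt G x (hessAt G f x)
      + ((c * (Fintype.card ι : ℝ) - 1) * mtrAt G x (W x)) * ricAt G x (sharpAt G x (fderiv ℝ f x)) (sharpAt G x (fderiv ℝ f x))
      - (c * mtrAt G x (W x) * ∑ i, (∑ k, cov₃At G (cov₂At G Bf) x (e k) (e k) (e i) (e i)) - ∑ i, ∑ j, W x (e j) (e i) * (∑ k, cov₃At G (cov₂At G Bf) x (e k) (e k) (e i) (e j)))
      + (c * mtrAt G x (W x) * ∑ i, (∑ k, ((hessAt G f x (e i) (riemAt G x (e k) (e i) (e k)) + fderiv ℝ f x (covRiemAt G x (e i) (e k) (e i) (e k))) + (hessAt G f x (e k) (riemAt G x (e k) (e i) (e i)) + fderiv ℝ f x (covRiemAt G x (e k) (e k) (e i) (e i))) + hessAt G f x (riemAt G x (e k) (e i) (e k)) (e i) + hessAt G f x (e k) (riemAt G x (e k) (e i) (e i)))) - ∑ i, ∑ j, W x (e j) (e i) * (∑ k, ((hessAt G f x (e i) (riemAt G x (e k) (e j) (e k)) + fderiv ℝ f x (covRiemAt G x (e i) (e k) (e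 j) (e k))) + (hessAt G f x (e k) (riemAt G x (e k) (e i) (e j)) + fderiv ℝ f x (covRiemAt G x (e k) (e k) (e i) (e j))) + hessAt G f x (riemAt G x (e k) (e i) (e k)) (e j) + hessAt G f x (e k) (riemAt G x (e k) (e i) (e j)))))
      + 2 * fderiv ℝ Φ x (sharpAt G x (fderiv ℝ f x))
      - 2 * (c * mtrAt G x (W x) * ∑ i, ((hessAt G f x (sharpAt G x (fderiv ℝ f x)) (e i) * fderiv ℝ f x (e i) + fderiv ℝ f x (e i) * hessAt G f x (sharpAt G x (fderiv ℝ f x)) (e i))) - ∑ i, ∑ j, W x (e j) (e i) * ((hessAt G f x (sharpAt G x (fderiv ℝ f x)) (e i) * fderiv ℝ f x (e j) + fderiv ℝ f x (e i) * hessAt G f x (sharpAt G x (fderiv ℝ f x)) (e j))))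
      - 2 * (c * mtrAt G x (W x) * ∑ i, (cov₂At G Bf x (sharpAt G x (fderiv ℝ f x)) (e i) (e i)) - ∑ i, ∑ j, W x (e j) (e i) * (cov₂At G Bf x (sharpAt G x (fderiv ℝ f x)) (e i) (e j)))
      - 2 * (c * mtrAt G x (W x) * ∑ i, (fderiv ℝ f x (riemAt G x (e i) (sharpAt G x (fderiv ℝ f x)) (e i))) - ∑ i, ∑ j, W x (e j) (e i) * (fderiv ℝ f x (riemAt G x (e i) (sharpAt G x (fderiv ℝ f x)) (e j)))) := by
    linear_combination hexp + 2 * hexp2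
      + (1 / 2 * lapAt G (gradSqAt G f) x + 2 * hessAt G f x (sharpAt G x (fderiv ℝ f x)) (sharpAt G x (fderiv ℝ f x))) * hg
      + (((c * (Fintype.card ι : ℝ) - 1) * mtrAt G x (W x)) / 2) * hΔγ + ((c * (Fintype.card ι : ℝ) - 1) * mtrAt G x (W x)) * hcritZ + 2 * hD1
  have hmain0 : ((c * (Fintype.card ι : ℝ) - 1) * mtrAt G x (W x)) * normSqAt G x (hessAt G f x) ≤
      -lapAt G Φ x + (∑ k, fderiv ℝ Φ x (e k) ^ 2) / (2 * Φ x)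
      + (c * mtrAt G x (W x) * ∑ i, (((fderiv ℝ (lapAt G f) x (e i) + ricAt G x (sharpAt G x (fderiv ℝ f x)) (e i)) * fderiv ℝ f x (e i) + fderiv ℝ f x (e i) * (fderiv ℝ (lapAt G f) x (e i) + ricAt G x (sharpAt G x (fderiv ℝ f x)) (e i)))) - ∑ i, ∑ j, W x (e j) (e i) * (((fderiv ℝ (lapAt G f) x (e i) + ricAt G x (sharpAt G x (fderiv ℝ f x)) (e i)) * fderiv ℝ f x (e j) + fderiv ℝ f x (e i) * (fderiv ℝ (lapAt G f) x (e j) + ricAt G x (sharpAt G x (fderiv ℝ f x)) (e j)))))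
      - ((c * (Fintype.card ι : ℝ) - 1) * mtrAt G x (W x)) * ricAt G x (sharpAt G x (fderiv ℝ f x)) (sharpAt G x (fderiv ℝ f x))
      + (c * mtrAt G x (W x) * ∑ i, (∑ k, cov₃At G (cov₂At G Bf) x (e k) (e k) (e i) (e i)) - ∑ i, ∑ j, W x (e j) (e i) * (∑ k, cov₃At G (cov₂At G Bf) x (e k) (e k) (e i) (e j)))
      - (c * mtrAt G x (W x) * ∑ i, (∑ k, ((hessAt G f x (e i) (riemAt G x (e k) (e i) (e k)) + fderiv ℝ f x (covRiemAt G x (e i) (e k) (e i) (e k))) + (hessAt G f x (e k) (riemAt G x (e k) (e i) (e i)) + fderiv ℝ f x (covRiemAt G x (e k) (e k) (e i) (e i))) + hessAt G f x (riemAt G x (e k) (e i) (e k)) (e i) + hessAt G f x (e k) (riemAt G x (e k) (e i) (e i)))) - ∑ i, ∑ j, W x (e j) (e i) * (∑ k, ((hessAt G f x (e i) (riemAt G x (e k) (e j) (e k)) + fderiv ℝ f x (covRiemAt G x (e i) (e k) (e j) (e k))) + (hessAt G f x (e k) (riemAt G x (e k) (e i) (e j)) + fderiv ℝ f x (covRiemAt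 G x (e k) (e k) (e i) (e j))) + hessAt G f x (riemAt G x (e k) (e i) (e k)) (e j) + hessAt G f x (e k) (riemAt G x (e k) (e i) (e j)))))
      - 2 * fderiv ℝ Φ x (sharpAt G x (fderiv ℝ f x))
      + 2 * (c * mtrAt G x (W x) * ∑ i, ((hessAt G f x (sharpAt G x (fderiv ℝ f x)) (e i) * fderiv ℝ f x (e i) + fderiv ℝ f x (e i) * hessAt G f x (sharpAt G x (fderiv ℝ f x)) (e i))) - ∑ i, ∑ j, W x (e j) (e i) * ((hessAt G f x (sharpAt G x (fderiv ℝ f x)) (e i) * fderiv ℝ f x (e j) + fderiv ℝ f x (e i) * hessAt G f x (sharpAt G x (fderiv ℝ f x)) (e j))))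
      + 2 * (c * mtrAt G x (W x) * ∑ i, (cov₂At G Bf x (sharpAt G x (fderiv ℝ f x)) (e i) (e i)) - ∑ i, ∑ j, W x (e j) (e i) * (cov₂At G Bf x (sharpAt G x (fderiv ℝ f x)) (e i) (e j)))
      + 2 * (c * mtrAt G x (W x) * ∑ i, (fderiv ℝ f x (riemAt G x (e i) (sharpAt G x (fderiv ℝ f x)) (e i))) - ∑ i, ∑ j, W x (e j) (e i) * (fderiv ℝ f x (riemAt G x (e i) (sharpAt G x (fderiv ℝ f x)) (e j)))) := by
    linarith only [hA0, hEq, hD2]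
  -- Step 6: frame expansions of `Z = ♯df`, of vectors, and the entry bounds
  have hn' : (2 : ℝ) ≤ (Fintype.card ι : ℝ) := by exact_mod_cast hn
  have hn1 : (1 : ℝ) ≤ (Fintype.card ι : ℝ) := by linarith only [hn']
  have hK0 : 0 ≤ K := by linarith only [hK]
  have hc₁0 : 0 ≤ c₁ := by linarith only [hc, hc₁]
  have hZ : sharpAt G x (fderiv ℝ f x) = ∑ m, fderiv ℝ f x (e m) • e m :=
    sharpAt_eq_sum_frame e he hi hs (fderiv ℝ f x)
  have hd : ∀ m, |fderiv ℝ f x (e m)| ≤ K := by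
    intro m
    have h1 : fderiv ℝ f x (e m) ^ 2 ≤ gradSqAt G f x := by
      rw [gradSqAt_eq_sum_frame e he hi hs f]
      exact Finset.single_le_sum (f := fun c ↦ fderiv ℝ f x (e c) ^ 2) (fun _ _ ↦ sq_nonneg _)
        (Finset.mem_univ m)
    exact abs_le.2 (abs_le_of_sq_le_sq' (h1.trans hγ) hK0)
  have hHv : ∀ v w, hessAt G f x v w = ∑ p, G x w (e p) * hessAt G f x v (e p) := by
    intro v w
    conv_lhs => rw [← sum_apply_smul_of_orthonormal e he w]
    rw [map_sum]
    exact Finset.sum_congr rfl fun p _ ↦ by rw [map_smul, smul_eq_mul]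
  have hDv : ∀ w, fderiv ℝ f x w = ∑ p, G x w (e p) * fderiv ℝ f x (e p) := by
    intro w
    conv_lhs => rw [← sum_apply_smul_of_orthonormal e he w]
    rw [map_sum]
    exact Finset.sum_congr rfl fun p _ ↦ by rw [map_smul, smul_eq_mul]
  have hHZ : ∀ v, hessAt G f x v (sharpAt G x (fderiv ℝ f x)) = ∑ m, fderiv ℝ f x (e m) * hessAt G f x v (e m) := fun v ↦
    apply_sharpAt_eq_sum_frame e he hi hs (hessAt G f x v) (fderiv ℝ f x)
  have hZH : ∀ v, hessAt G f x (sharpAt G x (fderiv ℝ f x)) v = ∑ m, fderiv ℝ f x (e m) * hessAt G f x v (e m) := fun v ↦ by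
    rw [hG.hessAt_comm hx hfx (sharpAt G x (fderiv ℝ f x)) v, hHZ]
  have hRic1 : ∀ v, ricAt G x (sharpAt G x (fderiv ℝ f x)) v = ∑ m, fderiv ℝ f x (e m) * ricAt G x (e m) v := by
    intro v
    rw [hZ]
    simp only [map_sum, map_smul, FunLike.coe_sum, Finset.sum_apply, FunLike.coe_smul,
      Pi.smul_apply, smul_eq_mul]
  have hRic2 : ∀ v, ricAt G x v (sharpAt G x (fderiv ℝ f x)) = ∑ m, fderiv ℝ f x (e m) * ricAt G x v (e m) := by
    intro v
    rw [hZ]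
    simp only [map_sum, map_smul, smul_eq_mul]
  have hDΦZ : fderiv ℝ Φ x (sharpAt G x (fderiv ℝ f x)) = ∑ m, fderiv ℝ f x (e m) * fderiv ℝ Φ x (e m) := by
    rw [hZ]
    simp only [map_sum, map_smul, smul_eq_mul]
  have hB1Z : ∀ v w, cov₂At G Bf x (sharpAt G x (fderiv ℝ f x)) v w = ∑ m, fderiv ℝ f x (e m) * cov₂At G Bf x (e m) v w := by
    intro v w
    rw [hZ]
    simp only [map_sum, map_smul, FunLike.coe_sum, Finset.sum_apply, FunLike.coe_smul,
      Pi.smul_apply, smul_eq_mul]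
  have hRZ : ∀ v w, fderiv ℝ f x (riemAt G x v (sharpAt G x (fderiv ℝ f x)) w) = ∑ m, fderiv ℝ f x (e m) * fderiv ℝ f x (riemAt G x v (e m) w) := by
    intro v w
    rw [← riemCLM_apply G x v (sharpAt G x (fderiv ℝ f x)), hZ]
    simp only [map_sum, map_smul, FunLike.coe_sum, Finset.sum_apply, FunLike.coe_smul,
      Pi.smul_apply, smul_eq_mul, riemCLM_apply]
  -- entry bounds derived from the hypotheses
  have hRic : ∀ a b, |ricAt G x (e a) (e b)| ≤ (Fintype.card ι : ℝ) * K := by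
    intro a b
    rw [ricAt_eq_sum_of_orthonormal e he (e a) (e b)]
    exact (Finset.abs_sum_le_sum_abs _ _).trans (sum_abs_le_card_mul fun i ↦ hKR i a b i)
  have hHR : ∀ (v wv : E), (∀ p, |G x wv (e p)| ≤ K) →
      |hessAt G f x v wv| ≤ K * ∑ p, |hessAt G f x v (e p)| := by
    intro v wv hwv
    rw [hHv v wv]
    exact abs_sum_mul_le hwv
  have hDR : ∀ wv : E, (∀ p, |G x wv (e p)| ≤ K) → |fderiv ℝ f x wv| ≤ K * ((Fintype.card ι : ℝ) * K) := by
    intro wv hwv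
    rw [hDv wv]
    exact (abs_sum_mul_le hwv).trans (mul_le_mul_of_nonneg_left (sum_abs_le_card_mul hd) hK0)
  -- `S_v = Σ_p |Hess f(v, e_p)| ≤ S` for frame vectors, and nonnegativity
  have hS0 : 0 ≤ (∑ i, ∑ j, |hessAt G f x (e i) (e j)|) := Finset.sum_nonneg fun i _ ↦ Finset.sum_nonneg fun j _ ↦ abs_nonneg _
  have hSi : ∀ i, ∑ p, |hessAt G f x (e i) (e p)| ≤ (∑ i, ∑ j, |hessAt G f x (e i) (e j)|) := fun i ↦
    Finset.single_le_sum (f := fun i ↦ ∑ p, |hessAt G f x (e i) (e p)|)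
      (fun _ _ ↦ Finset.sum_nonneg fun _ _ ↦ abs_nonneg _) (Finset.mem_univ i)
  have hSi0 : ∀ v, 0 ≤ ∑ p, |hessAt G f x v (e p)| := fun v ↦ Finset.sum_nonneg fun _ _ ↦ abs_nonneg _
  -- Step 7: the junk arrays, entry by entry and summed
  -- (θ) `θ_i = ∂_i Δf + Ric(Z, e_i)`
  have hθ : ∀ i, |fderiv ℝ (lapAt G f) x (e i) + ricAt G x (sharpAt G x (fderiv ℝ f x)) (e i)| ≤
      2 * K * (∑ i, ∑ j, |hessAt G f x (e i) (e j)|) + (Fintype.card ι : ℝ) * K * ((Fintype.card ι : ℝ) * K) := by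
    intro i
    rw [hG.fderiv_lapAt_of_isLocalMax hx hf hmax (e i), hHZ (e i), hRic1 (e i)]
    have h1 : |∑ m, fderiv ℝ f x (e m) * hessAt G f x (e i) (e m)| ≤ K * (∑ i, ∑ j, |hessAt G f x (e i) (e j)|) :=
      (abs_sum_mul_le hd).trans (mul_le_mul_of_nonneg_left (hSi i) hK0)
    have h2 : |∑ m, fderiv ℝ f x (e m) * ricAt G x (e m) (e i)| ≤ K * ((Fintype.card ι : ℝ) * ((Fintype.card ι : ℝ) * K)) :=
      (abs_sum_mul_le hd).trans
        (mul_le_mul_of_nonneg_left (sum_abs_le_card_mul fun m ↦ hRic m i) hK0)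
    have h3 := abs_add_le (-(2 * ∑ m, fderiv ℝ f x (e m) * hessAt G f x (e i) (e m)))
      (∑ m, fderiv ℝ f x (e m) * ricAt G x (e m) (e i))
    rw [abs_neg, abs_mul, abs_two] at h3
    linarith only [h1, h2, h3]
  have hb : ∑ i, ∑ j, |((fderiv ℝ (lapAt G f) x (e i) + ricAt G x (sharpAt G x (fderiv ℝ f x)) (e i)) * fderiv ℝ f x (e j) + fderiv ℝ f x (e i) * (fderiv ℝ (lapAt G f) x (e j) + ricAt G x (sharpAt G x (fderiv ℝ f x)) (e j)))| ≤ 4 * (Fintype.card ι : ℝ) ^ 2 * K ^ 2 * (∑ i, ∑ j, |hessAt G f x (e i) (e j)|) + 2 * (Fintype.card ι : ℝ) ^ 4 * K ^ 3 := by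
    have hent : ∀ i j, |((fderiv ℝ (lapAt G f) x (e i) + ricAt G x (sharpAt G x (fderiv ℝ f x)) (e i)) * fderiv ℝ f x (e j) + fderiv ℝ f x (e i) * (fderiv ℝ (lapAt G f) x (e j) + ricAt G x (sharpAt G x (fderiv ℝ f x)) (e j)))| ≤ 2 * K * (2 * K * (∑ i, ∑ j, |hessAt G f x (e i) (e j)|) + (Fintype.card ι : ℝ) * K * ((Fintype.card ι : ℝ) * K)) := by
      intro i j
      have hΘ0 : 0 ≤ 2 * K * (∑ i, ∑ j, |hessAt G f x (e i) (e j)|) + (Fintype.card ι : ℝ) * K * ((Fintype.card ι : ℝ) * K) := by positivity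
      have p1 := mul_le_mul (hθ i) (hd j) (abs_nonneg _) hΘ0
      have p2 := mul_le_mul (hd i) (hθ j) (abs_nonneg _) hK0
      refine (abs_add_le _ _).trans ?_
      rw [abs_mul, abs_mul]
      linarith only [p1, p2]
    calc ∑ i, ∑ j, |((fderiv ℝ (lapAt G f) x (e i) + ricAt G x (sharpAt G x (fderiv ℝ f x)) (e i)) * fderiv ℝ f x (e j) + fderiv ℝ f x (e i) * (fderiv ℝ (lapAt G f) x (e j) + ricAt G x (sharpAt G x (fderiv ℝ f x)) (e j)))| ≤ ∑ i : ι, ∑ j : ι, 2 * K * (2 * K * (∑ i, ∑ j, |hessAt G f x (e i) (e j)|) + (Fintype.card ι : ℝ) * K * ((Fintype.card ι : ℝ) * K)) :=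
          Finset.sum_le_sum fun i _ ↦ Finset.sum_le_sum fun j _ ↦ hent i j
      _ = (Fintype.card ι : ℝ) ^ 2 * (2 * K * (2 * K * (∑ i, ∑ j, |hessAt G f x (e i) (e j)|) + (Fintype.card ι : ℝ) * K * ((Fintype.card ι : ℝ) * K))) := by
          simp only [Finset.sum_const, Finset.card_univ, nsmul_eq_mul]; ring
      _ = 4 * (Fintype.card ι : ℝ) ^ 2 * K ^ 2 * (∑ i, ∑ j, |hessAt G f x (e i) (e j)|) + 2 * (Fintype.card ι : ℝ) ^ 4 * K ^ 3 := by ring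
  -- (d) `Σ_k ∇²B(e_k,e_k,e_i,e_j)`
  have hdd : ∑ i, ∑ j, |∑ k, cov₃At G (cov₂At G Bf) x (e k) (e k) (e i) (e j)| ≤ (Fintype.card ι : ℝ) ^ 3 * K := by
    have hent : ∀ i j, |∑ k, cov₃At G (cov₂At G Bf) x (e k) (e k) (e i) (e j)| ≤ (Fintype.card ι : ℝ) * K := fun i j ↦
      (Finset.abs_sum_le_sum_abs _ _).trans (sum_abs_le_card_mul fun k ↦ hKB2 k k i j)
    calc ∑ i, ∑ j, |∑ k, cov₃At G (cov₂At G Bf) x (e k) (e k) (e i) (e j)| ≤ ∑ i : ι, ∑ j : ι, (Fintype.card ι : ℝ) * K :=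
          Finset.sum_le_sum fun i _ ↦ Finset.sum_le_sum fun j _ ↦ hent i j
      _ = (Fintype.card ι : ℝ) ^ 3 * K := by simp only [Finset.sum_const, Finset.card_univ, nsmul_eq_mul]; ring
  -- (m) the curvature commutator terms
  have hm : ∑ i, ∑ j, |∑ k, ((hessAt G f x (e i) (riemAt G x (e k) (e j) (e k)) + fderiv ℝ f x (covRiemAt G x (e i) (e k) (e j) (e k))) + (hessAt G f x (e k) (riemAt G x (e k) (e i) (e j)) + fderiv ℝ f x (covRiemAt G x (e k) (e k) (e i) (e j))) + hessAt G f x (riemAt G x (e k) (e i) (e k)) (e j) + hessAt G f x (e k) (riemAt G x (e k) (e i) (e j)))| ≤ 4 * (Fintype.card ι : ℝ) ^ 3 * K * (∑ i, ∑ j, |hessAt G f x (e i) (e j)|) + 2 * (Fintype.card ι : ℝ) ^ 4 * K ^ 2 := by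
    have hent : ∀ i j, |∑ k, ((hessAt G f x (e i) (riemAt G x (e k) (e j) (e k)) + fderiv ℝ f x (covRiemAt G x (e i) (e k) (e j) (e k))) + (hessAt G f x (e k) (riemAt G x (e k) (e i) (e j)) + fderiv ℝ f x (covRiemAt G x (e k) (e k) (e i) (e j))) + hessAt G f x (riemAt G x (e k) (e i) (e k)) (e j) + hessAt G f x (e k) (riemAt G x (e k) (e i) (e j)))| ≤
        ∑ k : ι, (2 * (K * (∑ i, ∑ j, |hessAt G f x (e i) (e j)|)) + 2 * (K * ((Fintype.card ι : ℝ) * K)) + 2 * (K * ∑ p, |hessAt G f x (e k) (e p)|)) := by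
      intro i j
      refine (Finset.abs_sum_le_sum_abs _ _).trans (Finset.sum_le_sum fun k _ ↦ ?_)
      have t1 : |hessAt G f x (e i) (riemAt G x (e k) (e j) (e k))| ≤ K * (∑ i, ∑ j, |hessAt G f x (e i) (e j)|) :=
        (hHR (e i) _ fun p ↦ hKR k j k p).trans (mul_le_mul_of_nonneg_left (hSi i) hK0)
      have t2 : |fderiv ℝ f x (covRiemAt G x (e i) (e k) (e j) (e k))| ≤ K * ((Fintype.card ι : ℝ) * K) :=
        hDR _ fun p ↦ hKDR i k j k p
      have t3 : |hessAt G f x (e k) (riemAt G x (e k) (e i) (e j))| ≤ K * ∑ p, |hessAt G f x (e k) (e p)| :=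
        hHR (e k) _ fun p ↦ hKR k i j p
      have t4 : |fderiv ℝ f x (covRiemAt G x (e k) (e k) (e i) (e j))| ≤ K * ((Fintype.card ι : ℝ) * K) :=
        hDR _ fun p ↦ hKDR k k i j p
      have t5 : |hessAt G f x (riemAt G x (e k) (e i) (e k)) (e j)| ≤ K * (∑ i, ∑ j, |hessAt G f x (e i) (e j)|) := by
        rw [hG.hessAt_comm hx hfx _ (e j)]
        exact (hHR (e j) _ fun p ↦ hKR k i k p).trans (mul_le_mul_of_nonneg_left (hSi j) hK0)
      have t6 : |hessAt G f x (e k) (riemAt G x (e k) (e i) (e j))| ≤ K * ∑ p, |hessAt G f x (e k) (e p)| :=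
        hHR (e k) _ fun p ↦ hKR k i j p
      have := abs_add_three
        (hessAt G f x (e i) (riemAt G x (e k) (e j) (e k)) + fderiv ℝ f x (covRiemAt G x (e i) (e k) (e j) (e k))
          + (hessAt G f x (e k) (riemAt G x (e k) (e i) (e j)) + fderiv ℝ f x (covRiemAt G x (e k) (e k) (e i) (e j))))
        (hessAt G f x (riemAt G x (e k) (e i) (e k)) (e j)) (hessAt G f x (e k) (riemAt G x (e k) (e i) (e j)))
      have h12 := abs_add_le
        (hessAt G f x (e i) (riemAt G x (e k) (e j) (e k)) + fderiv ℝ f x (covRiemAt G x (e i) (e k) (e j) (e k)))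
        (hessAt G f x (e k) (riemAt G x (e k) (e i) (e j)) + fderiv ℝ f x (covRiemAt G x (e k) (e k) (e i) (e j)))
      have h1 := abs_add_le (hessAt G f x (e i) (riemAt G x (e k) (e j) (e k)))
        (fderiv ℝ f x (covRiemAt G x (e i) (e k) (e j) (e k)))
      have h2 := abs_add_le (hessAt G f x (e k) (riemAt G x (e k) (e i) (e j)))
        (fderiv ℝ f x (covRiemAt G x (e k) (e k) (e i) (e j)))
      linarith only [this, h12, h1, h2, t1, t2, t3, t4, t5, t6]
    have hsumk : ∑ k : ι, (2 * (K * (∑ i, ∑ j, |hessAt G f x (e i) (e j)|)) + 2 * (K * ((Fintype.card ι : ℝ) * K)) + 2 * (K * ∑ p, |hessAt G f x (e k) (e p)|)) =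
        (Fintype.card ι : ℝ) * (2 * (K * (∑ i, ∑ j, |hessAt G f x (e i) (e j)|)) + 2 * (K * ((Fintype.card ι : ℝ) * K))) + 2 * (K * (∑ i, ∑ j, |hessAt G f x (e i) (e j)|)) := by
      rw [Finset.sum_add_distrib, Finset.sum_const, Finset.card_univ, nsmul_eq_mul, ← Finset.mul_sum,
        ← Finset.mul_sum]
    calc ∑ i, ∑ j, |∑ k, ((hessAt G f x (e i) (riemAt G x (e k) (e j) (e k)) + fderiv ℝ f x (covRiemAt G x (e i) (e k) (e j) (e k))) + (hessAt G f x (e k) (riemAt G x (e k) (e i) (e j)) + fderiv ℝ f x (covRiemAt G x (e k) (e k) (e i) (e j))) + hessAt G f x (riemAt G x (e k) (e i) (e k)) (e j) + hessAt G f x (e k) (riemAt G x (e k) (e i) (e j)))|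
        ≤ ∑ i : ι, ∑ j : ι, ((Fintype.card ι : ℝ) * (2 * (K * (∑ i, ∑ j, |hessAt G f x (e i) (e j)|)) + 2 * (K * ((Fintype.card ι : ℝ) * K))) + 2 * (K * (∑ i, ∑ j, |hessAt G f x (e i) (e j)|))) :=
          Finset.sum_le_sum fun i _ ↦ Finset.sum_le_sum fun j _ ↦ (hent i j).trans hsumk.le
      _ = (Fintype.card ι : ℝ) ^ 2 * ((Fintype.card ι : ℝ) * (2 * (K * (∑ i, ∑ j, |hessAt G f x (e i) (e j)|)) + 2 * (K * ((Fintype.card ι : ℝ) * K))) + 2 * (K * (∑ i, ∑ j, |hessAt G f x (e i) (e j)|))) := by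
          simp only [Finset.sum_const, Finset.card_univ, nsmul_eq_mul]; ring
      _ ≤ 4 * (Fintype.card ι : ℝ) ^ 3 * K * (∑ i, ∑ j, |hessAt G f x (e i) (e j)|) + 2 * (Fintype.card ι : ℝ) ^ 4 * K ^ 2 := by
          have hn3 : (Fintype.card ι : ℝ) ^ 2 ≤ (Fintype.card ι : ℝ) ^ 3 :=
            pow_le_pow_right₀ hn1 (by norm_num : 2 ≤ 3)
          have : (Fintype.card ι : ℝ) ^ 2 * (K * (∑ i, ∑ j, |hessAt G f x (e i) (e j)|)) ≤ (Fintype.card ι : ℝ) ^ 3 * (K * (∑ i, ∑ j, |hessAt G f x (e i) (e j)|)) :=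
            mul_le_mul_of_nonneg_right hn3 (mul_nonneg hK0 hS0)
          linarith only [this]
  -- (b2) `Hess f(Z, e_i) df(e_j) + df(e_i) Hess f(Z, e_j)`
  have hb2 : ∑ i, ∑ j, |(hessAt G f x (sharpAt G x (fderiv ℝ f x)) (e i) * fderiv ℝ f x (e j) + fderiv ℝ f x (e i) * hessAt G f x (sharpAt G x (fderiv ℝ f x)) (e j))| ≤ 2 * (Fintype.card ι : ℝ) ^ 2 * K ^ 2 * (∑ i, ∑ j, |hessAt G f x (e i) (e j)|) := by
    have hHZi : ∀ i, |hessAt G f x (sharpAt G x (fderiv ℝ f x)) (e i)| ≤ K * (∑ i, ∑ j, |hessAt G f x (e i) (e j)|) := fun i ↦ by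
      rw [hZH (e i)]
      exact (abs_sum_mul_le hd).trans (mul_le_mul_of_nonneg_left (hSi i) hK0)
    have hent : ∀ i j, |(hessAt G f x (sharpAt G x (fderiv ℝ f x)) (e i) * fderiv ℝ f x (e j) + fderiv ℝ f x (e i) * hessAt G f x (sharpAt G x (fderiv ℝ f x)) (e j))| ≤ 2 * (K * (∑ i, ∑ j, |hessAt G f x (e i) (e j)|) * K) := by
      intro i j
      have hΘ0 : 0 ≤ K * (∑ i, ∑ j, |hessAt G f x (e i) (e j)|) := by positivity
      have p1 := mul_le_mul (hHZi i) (hd j) (abs_nonneg _) hΘ0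
      have p2 := mul_le_mul (hd i) (hHZi j) (abs_nonneg _) hK0
      refine (abs_add_le _ _).trans ?_
      rw [abs_mul, abs_mul]
      linarith only [p1, p2]
    calc ∑ i, ∑ j, |(hessAt G f x (sharpAt G x (fderiv ℝ f x)) (e i) * fderiv ℝ f x (e j) + fderiv ℝ f x (e i) * hessAt G f x (sharpAt G x (fderiv ℝ f x)) (e j))| ≤ ∑ i : ι, ∑ j : ι, 2 * (K * (∑ i, ∑ j, |hessAt G f x (e i) (e j)|) * K) :=
          Finset.sum_le_sum fun i _ ↦ Finset.sum_le_sum fun j _ ↦ hent i j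
      _ = 2 * (Fintype.card ι : ℝ) ^ 2 * K ^ 2 * (∑ i, ∑ j, |hessAt G f x (e i) (e j)|) := by
          simp only [Finset.sum_const, Finset.card_univ, nsmul_eq_mul]; ring
  -- (d2) `(∇_Z B)(e_i, e_j)`
  have hd2 : ∑ i, ∑ j, |cov₂At G Bf x (sharpAt G x (fderiv ℝ f x)) (e i) (e j)| ≤ (Fintype.card ι : ℝ) ^ 3 * K ^ 2 := by
    have hent : ∀ i j, |cov₂At G Bf x (sharpAt G x (fderiv ℝ f x)) (e i) (e j)| ≤ K * ((Fintype.card ι : ℝ) * K) := by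
      intro i j
      rw [hB1Z (e i) (e j)]
      exact (abs_sum_mul_le hd).trans
        (mul_le_mul_of_nonneg_left (sum_abs_le_card_mul fun m ↦ hKB1 m i j) hK0)
    calc ∑ i, ∑ j, |cov₂At G Bf x (sharpAt G x (fderiv ℝ f x)) (e i) (e j)| ≤ ∑ i : ι, ∑ j : ι, K * ((Fintype.card ι : ℝ) * K) :=
          Finset.sum_le_sum fun i _ ↦ Finset.sum_le_sum fun j _ ↦ hent i j
      _ = (Fintype.card ι : ℝ) ^ 3 * K ^ 2 := by simp only [Finset.sum_const, Finset.card_univ, nsmul_eq_mul]; ring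
  -- (m2) `df(R(e_i, Z) e_j)`
  have hm2 : ∑ i, ∑ j, |fderiv ℝ f x (riemAt G x (e i) (sharpAt G x (fderiv ℝ f x)) (e j))| ≤ (Fintype.card ι : ℝ) ^ 4 * K ^ 3 := by
    have hent : ∀ i j, |fderiv ℝ f x (riemAt G x (e i) (sharpAt G x (fderiv ℝ f x)) (e j))| ≤ K * ((Fintype.card ι : ℝ) * (K * ((Fintype.card ι : ℝ) * K))) := by
      intro i j
      rw [hRZ (e i) (e j)]
      exact (abs_sum_mul_le hd).trans (mul_le_mul_of_nonneg_left
        (sum_abs_le_card_mul fun m ↦ hDR _ fun p ↦ hKR i m j p) hK0)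
    calc ∑ i, ∑ j, |fderiv ℝ f x (riemAt G x (e i) (sharpAt G x (fderiv ℝ f x)) (e j))| ≤ ∑ i : ι, ∑ j : ι, K * ((Fintype.card ι : ℝ) * (K * ((Fintype.card ι : ℝ) * K))) :=
          Finset.sum_le_sum fun i _ ↦ Finset.sum_le_sum fun j _ ↦ hent i j
      _ = (Fintype.card ι : ℝ) ^ 4 * K ^ 3 := by simp only [Finset.sum_const, Finset.card_univ, nsmul_eq_mul]; ring
  -- scalars: `dΦ(Z)`, `Ric(Z,Z)`, `Σ_k (∂_k Φ)²`, `ΔΦ`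
  have hΦZ : |fderiv ℝ Φ x (sharpAt G x (fderiv ℝ f x))| ≤ K * ((Fintype.card ι : ℝ) * K) := by
    rw [hDΦZ]
    exact (abs_sum_mul_le hd).trans (mul_le_mul_of_nonneg_left (sum_abs_le_card_mul hKΦ1) hK0)
  have hRicZZ : |ricAt G x (sharpAt G x (fderiv ℝ f x)) (sharpAt G x (fderiv ℝ f x))| ≤ K * ((Fintype.card ι : ℝ) * (K * ((Fintype.card ι : ℝ) * ((Fintype.card ι : ℝ) * K)))) := by
    rw [hRic1 (sharpAt G x (fderiv ℝ f x))]
    refine (abs_sum_mul_le hd).trans (mul_le_mul_of_nonneg_left (sum_abs_le_card_mul fun m ↦ ?_) hK0)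
    rw [hRic2 (e m)]
    exact (abs_sum_mul_le hd).trans
      (mul_le_mul_of_nonneg_left (sum_abs_le_card_mul fun p ↦ hRic m p) hK0)
  have hΦsq : ∑ k, fderiv ℝ Φ x (e k) ^ 2 ≤ (Fintype.card ι : ℝ) * K ^ 2 := by
    refine sum_le_card_mul fun k ↦ ?_
    rw [← sq_abs]
    exact pow_le_pow_left₀ (abs_nonneg _) (hKΦ1 k) 2
  have hΦsq' : (∑ k, fderiv ℝ Φ x (e k) ^ 2) / (2 * Φ x) ≤ (Fintype.card ι : ℝ) * K ^ 2 / (2 * Φ₀) :=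
    (div_le_div_of_nonneg_right hΦsq (by positivity)).trans
      (div_le_div_of_nonneg_left (by positivity) (by positivity) (by linarith only [hΦ]))
  have hlapf : |lapAt G f x| ≤ (∑ i, ∑ j, |hessAt G f x (e i) (e j)|) := by
    rw [lapAt, mtrAt_eq_sum_frame e he hi (hessAt G f x)]
    exact (Finset.abs_sum_le_sum_abs _ _).trans (Finset.sum_le_sum fun i _ ↦
      Finset.single_le_sum (f := fun j ↦ |hessAt G f x (e i) (e j)|) (fun _ _ ↦ abs_nonneg _)
        (Finset.mem_univ i))
  have hlapΦ : -lapAt G Φ x ≤ K + K * (∑ i, ∑ j, |hessAt G f x (e i) (e j)|) := by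
    have h1 := (neg_le_abs _).trans hKΦ2
    have h2 : K * (1 + |lapAt G f x|) ≤ K * (1 + (∑ i, ∑ j, |hessAt G f x (e i) (e j)|)) :=
      mul_le_mul_of_nonneg_left (by linarith only [hlapf]) hK0
    linarith only [h1, h2]
  -- Step 8: the functional on the junk arrays, `|𝔞(t)| ≤ 2 c tr W Σ|t_ij|`
  have hcw : 0 ≤ c * mtrAt G x (W x) := by positivity
  have hWm : ∀ i j, |W x (e i) (e j)| ≤ c * mtrAt G x (W x) :=
    abs_apply_frame_le_of_cone e he hi hs hc hw.le hcone.le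
  have hAb := abs_linComb_le hcw (Wm := fun i j ↦ W x (e i) (e j)) hWm (fun i j ↦ ((fderiv ℝ (lapAt G f) x (e i) + ricAt G x (sharpAt G x (fderiv ℝ f x)) (e i)) * fderiv ℝ f x (e j) + fderiv ℝ f x (e i) * (fderiv ℝ (lapAt G f) x (e j) + ricAt G x (sharpAt G x (fderiv ℝ f x)) (e j))))
  have hAd := abs_linComb_le hcw (Wm := fun i j ↦ W x (e i) (e j)) hWm (fun i j ↦ ∑ k, cov₃At G (cov₂At G Bf) x (e k) (e k) (e i) (e j))
  have hAm := abs_linComb_le hcw (Wm := fun i j ↦ W x (e i) (e j)) hWm (fun i j ↦ ∑ k, ((hessAt G f x (e i) (riemAt G x (e k) (e j) (e k)) + fderiv ℝ f x (covRiemAt G x (e i) (e k) (e j) (e k))) + (hessAt G f x (e k) (riemAt G x (e k) (e i) (e j)) + fderiv ℝ f x (covRiemAt G x (e k) (e k) (e i) (e j))) + hessAt G f x (riemAt G x (e k) (e i) (e k)) (e j) + hessAt G f x (e k) (riemAt G x (e k) (e i) (e j))))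
  have hAb2 := abs_linComb_le hcw (Wm := fun i j ↦ W x (e i) (e j)) hWm (fun i j ↦ (hessAt G f x (sharpAt G x (fderiv ℝ f x)) (e i) * fderiv ℝ f x (e j) + fderiv ℝ f x (e i) * hessAt G f x (sharpAt G x (fderiv ℝ f x)) (e j)))
  have hAd2 := abs_linComb_le hcw (Wm := fun i j ↦ W x (e i) (e j)) hWm (fun i j ↦ cov₂At G Bf x (sharpAt G x (fderiv ℝ f x)) (e i) (e j))
  have hAm2 := abs_linComb_le hcw (Wm := fun i j ↦ W x (e i) (e j)) hWm (fun i j ↦ fderiv ℝ f x (riemAt G x (e i) (sharpAt G x (fderiv ℝ f x)) (e j)))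
  beta_reduce at hAb hAd hAm hAb2 hAd2 hAm2
  -- Step 9: collecting: `(cn−1) tr W |Hess f|² ≤ α + tr W (β + γ S)`
  have hW0 : 0 ≤ mtrAt G x (W x) := hw.le
  have hcn : (1 : ℝ) * 2 ≤ c * (Fintype.card ι : ℝ) := mul_le_mul hc hn' (by norm_num) (by linarith only [hc])
  have hM0 : 0 ≤ ((c * (Fintype.card ι : ℝ) - 1) * mtrAt G x (W x)) := mul_nonneg (by linarith only [hcn]) hW0
  have hMle : ((c * (Fintype.card ι : ℝ) - 1) * mtrAt G x (W x)) ≤ c₁ * (Fintype.card ι : ℝ) * mtrAt G x (W x) := by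
    have h1 : c * (Fintype.card ι : ℝ) * mtrAt G x (W x) ≤ c₁ * (Fintype.card ι : ℝ) * mtrAt G x (W x) :=
      mul_le_mul_of_nonneg_right (mul_le_mul_of_nonneg_right hc₁ (by positivity)) hW0
    linarith only [h1, hW0]
  have hc1W : c * mtrAt G x (W x) ≤ c₁ * mtrAt G x (W x) := mul_le_mul_of_nonneg_right hc₁ hW0
  -- monomial comparisons (`n ≥ 1`, `K ≥ 1`)
  have hnK : ∀ (p q : ℕ) (p' q' : ℕ), p ≤ p' → q ≤ q' → (Fintype.card ι : ℝ) ^ p * K ^ q ≤ (Fintype.card ι : ℝ) ^ p' * K ^ q' :=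
    fun p q p' q' hp hq ↦ mul_le_mul (pow_le_pow_right₀ hn1 hp) (pow_le_pow_right₀ hK hq)
      (by positivity) (by positivity)
  have hmain : ((c * (Fintype.card ι : ℝ) - 1) * mtrAt G x (W x)) * normSqAt G x (hessAt G f x) ≤
      (K + (Fintype.card ι : ℝ) * K ^ 2 / (2 * Φ₀) + 2 * (Fintype.card ι : ℝ) * K ^ 2) + K * (∑ i, ∑ j, |hessAt G f x (e i) (e j)|) + mtrAt G x (W x) * ((19 * c₁ * (Fintype.card ι : ℝ) ^ 4 * K ^ 3) + (24 * c₁ * (Fintype.card ι : ℝ) ^ 3 * K ^ 2) * (∑ i, ∑ j, |hessAt G f x (e i) (e j)|)) := by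
    have e1 : (c * mtrAt G x (W x) * ∑ i, (((fderiv ℝ (lapAt G f) x (e i) + ricAt G x (sharpAt G x (fderiv ℝ f x)) (e i)) * fderiv ℝ f x (e i) + fderiv ℝ f x (e i) * (fderiv ℝ (lapAt G f) x (e i) + ricAt G x (sharpAt G x (fderiv ℝ f x)) (e i)))) - ∑ i, ∑ j, W x (e j) (e i) * (((fderiv ℝ (lapAt G f) x (e i) + ricAt G x (sharpAt G x (fderiv ℝ f x)) (e i)) * fderiv ℝ f x (e j) + fderiv ℝ f x (e i) * (fderiv ℝ (lapAt G f) x (e j) + ricAt G x (sharpAt G x (fderiv ℝ f x)) (e j))))) ≤ 2 * (c₁ * mtrAt G x (W x)) * (4 * (Fintype.card ι : ℝ) ^ 2 * K ^ 2 * (∑ i, ∑ j, |hessAt G f x (e i) (e j)|) + 2 * (Fintype.card ι : ℝ) ^ 4 * K ^ 3) :=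
      (le_abs_self _).trans (hAb.trans (by gcongr))
    have e2 : (c * mtrAt G x (W x) * ∑ i, (∑ k, cov₃At G (cov₂At G Bf) x (e k) (e k) (e i) (e i)) - ∑ i, ∑ j, W x (e j) (e i) * (∑ k, cov₃At G (cov₂At G Bf) x (e k) (e k) (e i) (e j))) ≤ 2 * (c₁ * mtrAt G x (W x)) * ((Fintype.card ι : ℝ) ^ 3 * K) :=
      (le_abs_self _).trans (hAd.trans (by gcongr))
    have e3 : -(c * mtrAt G x (W x) * ∑ i, (∑ k, ((hessAt G f x (e i) (riemAt G x (e k) (e i) (e k)) + fderiv ℝ f x (covRiemAt G x (e i) (e k) (e i) (e k))) + (hessAt G f x (e k) (riemAt G x (e k) (e i) (e i)) + fderiv ℝ f x (covRiemAt G x (e k) (e k) (e i) (e i))) + hessAt G f x (riemAt G x (e k) (e i) (e k)) (e i) + hessAt G f x (e k) (riemAt G x (e k) (e i) (e i)))) - ∑ i, ∑ j, W x (e j) (e i) * (∑ k, ((hessAt G f x (e i) (riemAt G x (e k) (e j) (e k)) + fderiv ℝ f x (covRiemAt G x (e i) (e k) (e j) (e k))) + (hessAt G f x (e k) (riemAt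 G x (e k) (e i) (e j)) + fderiv ℝ f x (covRiemAt G x (e k) (e k) (e i) (e j))) + hessAt G f x (riemAt G x (e k) (e i) (e k)) (e j) + hessAt G f x (e k) (riemAt G x (e k) (e i) (e j))))) ≤ 2 * (c₁ * mtrAt G x (W x)) * (4 * (Fintype.card ι : ℝ) ^ 3 * K * (∑ i, ∑ j, |hessAt G f x (e i) (e j)|) + 2 * (Fintype.card ι : ℝ) ^ 4 * K ^ 2) :=
      (neg_le_abs _).trans (hAm.trans (by gcongr))
    have e4 : (c * mtrAt G x (W x) * ∑ i, ((hessAt G f x (sharpAt G x (fderiv ℝ f x)) (e i) * fderiv ℝ f x (e i) + fderiv ℝ f x (e i) * hessAt G f x (sharpAt G x (fderiv ℝ f x)) (e i))) - ∑ i, ∑ j, W x (e j) (e i) * ((hessAt G f x (sharpAt G x (fderiv ℝ f x)) (e i) * fderiv ℝ f x (e j) + fderiv ℝ f x (e i) * hessAt G f x (sharpAt G x (fderiv ℝ f x)) (e j)))) ≤ 2 * (c₁ * mtrAt G x (W x)) * (2 * (Fintype.card ι : ℝ) ^ 2 * K ^ 2 * (∑ i, ∑ j, |hessAt G f x (e i)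 (e j)|)) :=
      (le_abs_self _).trans (hAb2.trans (by gcongr))
    have e5 : (c * mtrAt G x (W x) * ∑ i, (cov₂At G Bf x (sharpAt G x (fderiv ℝ f x)) (e i) (e i)) - ∑ i, ∑ j, W x (e j) (e i) * (cov₂At G Bf x (sharpAt G x (fderiv ℝ f x)) (e i) (e j))) ≤ 2 * (c₁ * mtrAt G x (W x)) * ((Fintype.card ι : ℝ) ^ 3 * K ^ 2) :=
      (le_abs_self _).trans (hAd2.trans (by gcongr))
    have e6 : (c * mtrAt G x (W x) * ∑ i, (fderiv ℝ f x (riemAt G x (e i) (sharpAt G x (fderiv ℝ f x)) (e i))) - ∑ i, ∑ j, W x (e j) (e i) * (fderiv ℝ f x (riemAt G x (e i) (sharpAt G x (fderiv ℝ f x)) (e j)))) ≤ 2 * (c₁ * mtrAt G x (W x)) * ((Fintype.card ι : ℝ) ^ 4 * K ^ 3) :=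
      (le_abs_self _).trans (hAm2.trans (by gcongr))
    have e7 : -(((c * (Fintype.card ι : ℝ) - 1) * mtrAt G x (W x)) * ricAt G x (sharpAt G x (fderiv ℝ f x)) (sharpAt G x (fderiv ℝ f x))) ≤ (c₁ * (Fintype.card ι : ℝ) * mtrAt G x (W x)) * (K * ((Fintype.card ι : ℝ) * (K * ((Fintype.card ι : ℝ) * ((Fintype.card ι : ℝ) * K))))) := by
      have h1 : -(((c * (Fintype.card ι : ℝ) - 1) * mtrAt G x (W x)) * ricAt G x (sharpAt G x (fderiv ℝ f x)) (sharpAt G x (fderiv ℝ f x))) ≤ ((c * (Fintype.card ι : ℝ) - 1) * mtrAt G x (W x)) * |ricAt G x (sharpAt G x (fderiv ℝ f x)) (sharpAt G x (fderiv ℝ f x))| := by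
        rw [← mul_neg]; exact mul_le_mul_of_nonneg_left (neg_le_abs _) hM0
      exact h1.trans (mul_le_mul hMle hRicZZ (abs_nonneg _) (by positivity))
    have e8 : -(2 * fderiv ℝ Φ x (sharpAt G x (fderiv ℝ f x))) ≤ 2 * (K * ((Fintype.card ι : ℝ) * K)) := by
      have := neg_le_abs (fderiv ℝ Φ x (sharpAt G x (fderiv ℝ f x))); linarith only [this, hΦZ]
    -- compare monomials
    have w0 : 0 ≤ c₁ * mtrAt G x (W x) := by positivity
    have q1 : c₁ * mtrAt G x (W x) * ((Fintype.card ι : ℝ) ^ 2 * K ^ 2 * (∑ i, ∑ j, |hessAt G f x (e i) (e j)|)) ≤ c₁ * mtrAt G x (W x) * ((Fintype.card ι : ℝ) ^ 3 * K ^ 2 * (∑ i, ∑ j, |hessAt G f x (e i) (e j)|)) :=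
      mul_le_mul_of_nonneg_left (mul_le_mul_of_nonneg_right (hnK 2 2 3 2 (by norm_num) le_rfl) hS0) w0
    have k2 : (Fintype.card ι : ℝ) ^ 3 * K ≤ (Fintype.card ι : ℝ) ^ 3 * K ^ 2 := by
      have := hnK 3 1 3 2 le_rfl (by norm_num); rwa [pow_one] at this
    have k3 : (Fintype.card ι : ℝ) ^ 3 * K ≤ (Fintype.card ι : ℝ) ^ 4 * K ^ 3 := by
      have := hnK 3 1 4 3 (by norm_num) (by norm_num); rwa [pow_one] at this
    have q2 : c₁ * mtrAt G x (W x) * ((Fintype.card ι : ℝ) ^ 3 * K * (∑ i, ∑ j, |hessAt G f x (e i) (e j)|)) ≤ c₁ * mtrAt G x (W x) * ((Fintype.card ι : ℝ) ^ 3 * K ^ 2 * (∑ i, ∑ j, |hessAt G f x (e i) (e j)|)) :=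
      mul_le_mul_of_nonneg_left (mul_le_mul_of_nonneg_right k2 hS0) w0
    have q3 : c₁ * mtrAt G x (W x) * ((Fintype.card ι : ℝ) ^ 3 * K) ≤ c₁ * mtrAt G x (W x) * ((Fintype.card ι : ℝ) ^ 4 * K ^ 3) :=
      mul_le_mul_of_nonneg_left k3 w0
    have q4 : c₁ * mtrAt G x (W x) * ((Fintype.card ι : ℝ) ^ 4 * K ^ 2) ≤ c₁ * mtrAt G x (W x) * ((Fintype.card ι : ℝ) ^ 4 * K ^ 3) :=
      mul_le_mul_of_nonneg_left (hnK 4 2 4 3 le_rfl (by norm_num)) w0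
    have q5 : c₁ * mtrAt G x (W x) * ((Fintype.card ι : ℝ) ^ 3 * K ^ 2) ≤ c₁ * mtrAt G x (W x) * ((Fintype.card ι : ℝ) ^ 4 * K ^ 3) :=
      mul_le_mul_of_nonneg_left (hnK 3 2 4 3 (by norm_num) (by norm_num)) w0
    linarith only [hmain0, hlapΦ, hΦsq', e1, e2, e3, e4, e5, e6, e7, e8, q1, q2, q3, q4, q5]
  -- Step 10: the closing algebra
  have hN0 : 0 ≤ normSqAt G x (hessAt G f x) := by
    rw [normSqAt_eq_sum_frame e he hi hs (hessAt G f x)]; positivity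
  have hNW0 : 0 ≤ normSqAt G x (W x) := by
    rw [normSqAt_eq_sum_frame e he hi hs (W x)]; positivity
  have h2Φ0 : 2 * Φ₀ ≤ c * mtrAt G x (W x) ^ 2 := by linarith only [hQ, hΦ, hNW0]
  have hMW : mtrAt G x (W x) ≤ ((c * (Fintype.card ι : ℝ) - 1) * mtrAt G x (W x)) := by
    have := mul_nonneg (by linarith only [hcn] : (0 : ℝ) ≤ c * (Fintype.card ι : ℝ) - 2) hW0
    linarith only [this]
  have hWN : mtrAt G x (W x) * normSqAt G x (hessAt G f x) ≤
      (K + (Fintype.card ι : ℝ) * K ^ 2 / (2 * Φ₀) + 2 * (Fintype.card ι : ℝ) * K ^ 2) + K * (∑ i, ∑ j, |hessAt G f x (e i) (e j)|) + mtrAt G x (W x) * ((19 * c₁ * (Fintype.card ι : ℝ) ^ 4 * K ^ 3) + (24 * c₁ * (Fintype.card ι : ℝ) ^ 3 * K ^ 2) * (∑ i, ∑ j, |hessAt G f x (e i) (e j)|)) :=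
    (mul_le_mul_of_nonneg_right hMW hN0).trans hmain
  -- `1 ≤ tr W · ρ` with `ρ = (1 + c₁/(2Φ₀))/2`, from `c₁ (tr W)² ≥ 2Φ₀` and `w + 1/w ≥ 2`
  have hA : 2 * Φ₀ ≤ c₁ * mtrAt G x (W x) ^ 2 := h2Φ0.trans (mul_le_mul_of_nonneg_right hc₁ (sq_nonneg _))
  have hρ : 1 ≤ mtrAt G x (W x) * ((1 + c₁ / (2 * Φ₀)) / 2) := by
    have hw0 : mtrAt G x (W x) ≠ 0 := hw.ne'
    have h3 : 1 / mtrAt G x (W x) ≤ mtrAt G x (W x) * c₁ / (2 * Φ₀) := by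
      rw [div_le_div_iff₀ hw (by positivity), one_mul]
      nlinarith only [hA]
    have h4 : (mtrAt G x (W x) - 1) ^ 2 / mtrAt G x (W x) = mtrAt G x (W x) - 2 + 1 / mtrAt G x (W x) := by
      field_simp
      ring
    have h5 : 0 ≤ (mtrAt G x (W x) - 1) ^ 2 / mtrAt G x (W x) := div_nonneg (sq_nonneg _) hw.le
    have h6 : mtrAt G x (W x) * ((1 + c₁ / (2 * Φ₀)) / 2) = (mtrAt G x (W x) + mtrAt G x (W x) * c₁ / (2 * Φ₀)) / 2 := by ring
    rw [h6]
    linarith only [h3, h4, h5]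
  have hαS0 : 0 ≤ (K + (Fintype.card ι : ℝ) * K ^ 2 / (2 * Φ₀) + 2 * (Fintype.card ι : ℝ) * K ^ 2) + K * (∑ i, ∑ j, |hessAt G f x (e i) (e j)|) := by positivity
  have hNPQ : normSqAt G x (hessAt G f x) ≤
      ((K + (Fintype.card ι : ℝ) * K ^ 2 / (2 * Φ₀) + 2 * (Fintype.card ι : ℝ) * K ^ 2) + K * (∑ i, ∑ j, |hessAt G f x (e i) (e j)|)) * ((1 + c₁ / (2 * Φ₀)) / 2) + (19 * c₁ * (Fintype.card ι : ℝ) ^ 4 * K ^ 3) + (24 * c₁ * (Fintype.card ι : ℝ) ^ 3 * K ^ 2) * (∑ i, ∑ j, |hessAt G f x (e i) (e j)|) := by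
    refine le_of_mul_le_mul_left ?_ hw
    have h1 : mtrAt G x (W x) * (((K + (Fintype.card ι : ℝ) * K ^ 2 / (2 * Φ₀) + 2 * (Fintype.card ι : ℝ) * K ^ 2) + K * (∑ i, ∑ j, |hessAt G f x (e i) (e j)|)) * ((1 + c₁ / (2 * Φ₀)) / 2) + (19 * c₁ * (Fintype.card ι : ℝ) ^ 4 * K ^ 3) + (24 * c₁ * (Fintype.card ι : ℝ) ^ 3 * K ^ 2) * (∑ i, ∑ j, |hessAt G f x (e i) (e j)|)) =
        ((K + (Fintype.card ι : ℝ) * K ^ 2 / (2 * Φ₀) + 2 * (Fintype.card ι : ℝ) * K ^ 2) + K * (∑ i, ∑ j, |hessAt G f x (e i) (e j)|)) * (mtrAt G x (W x) * ((1 + c₁ / (2 * Φ₀)) / 2)) + mtrAt G x (W x) * ((19 * c₁ * (Fintype.card ι : ℝ) ^ 4 * K ^ 3) + (24 * c₁ * (Fintype.card ι : ℝ) ^ 3 * K ^ 2) * (∑ i, ∑ j, |hessAt G f x (e i) (e j)|)) := by ring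
    rw [h1]
    have h2 : (K + (Fintype.card ι : ℝ) * K ^ 2 / (2 * Φ₀) + 2 * (Fintype.card ι : ℝ) * K ^ 2) + K * (∑ i, ∑ j, |hessAt G f x (e i) (e j)|) ≤ ((K + (Fintype.card ι : ℝ) * K ^ 2 / (2 * Φ₀) + 2 * (Fintype.card ι : ℝ) * K ^ 2) + K * (∑ i, ∑ j, |hessAt G f x (e i) (e j)|)) * (mtrAt G x (W x) * ((1 + c₁ / (2 * Φ₀)) / 2)) :=
      le_mul_of_one_le_right hαS0 hρ
    linarith only [hWN, h2]
  have hkey : ((K + (Fintype.card ι : ℝ) * K ^ 2 / (2 * Φ₀) + 2 * (Fintype.card ι : ℝ) * K ^ 2) + K * (∑ i, ∑ j, |hessAt G f x (e i) (e j)|)) * ((1 + c₁ / (2 * Φ₀)) / 2) + (19 * c₁ * (Fintype.card ι : ℝ) ^ 4 * K ^ 3) + (24 * c₁ * (Fintype.card ι : ℝ) ^ 3 * K ^ 2) * (∑ i, ∑ j, |hessAt G f x (e i) (e j)|) =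
      ((K + (Fintype.card ι : ℝ) * K ^ 2 / (2 * Φ₀) + 2 * (Fintype.card ι : ℝ) * K ^ 2) * ((1 + c₁ / (2 * Φ₀)) / 2) + 19 * c₁ * (Fintype.card ι : ℝ) ^ 4 * K ^ 3)
      + (K * ((1 + c₁ / (2 * Φ₀)) / 2) + 24 * c₁ * (Fintype.card ι : ℝ) ^ 3 * K ^ 2) * (∑ i, ∑ j, |hessAt G f x (e i) (e j)|) := by ring
  rw [hkey] at hNPQ
  have hS2 : (∑ i, ∑ j, |hessAt G f x (e i) (e j)|) ^ 2 ≤ (Fintype.card ι : ℝ) ^ 2 * normSqAt G x (hessAt G f x) := by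
    have := sq_sum_sum_abs_le (fun i j ↦ hessAt G f x (e i) (e j))
    beta_reduce at this
    rwa [← normSqAt_eq_sum_frame e he hi hs (hessAt G f x)] at this
  exact final_algebra hN0 hNPQ hS2


/-- **The Laplacian estimate at a maximum point of `Δf + |∇f|²`, norm form**: the same statement
with the bounds on `∇B, ∇²B, Rm, ∇Rm, dΦ` given multilinearly in the norm of the model space and
a bound `‖e_a‖ ≤ κ` on the orthonormal frame (so that every frame entry is at most `K κ⁵`); this is
the form a compactness argument on a manifold delivers. [cite: Chen2005, Thm. 1(a), §3]
[cite: GurskyViaclovsky2003, Prop. 6] -/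
theorem IsMetricOn.normSqAt_hessAt_le_of_isLocalMax_of_norm (hG : IsMetricOn G V) (hx : x ∈ V)
    (hf : ContDiffOn ℝ ∞ f V) (hB : ContDiffOn ℝ ∞ Bf V)
    (hBs : ∀ y ∈ V, ∀ v w, Bf y v w = Bf y w v) (hW : W = (fun y ↦ hessAt G f y
      + ContinuousLinearMap.smulRightL ℝ E (E →L[ℝ] ℝ) (fderiv ℝ f y) (fderiv ℝ f y)
      - (1 / 2 : ℝ) • (gradSqAt G f y • G y) + Bf y))
    (hpos : ∀ v, v ≠ 0 → 0 < G x v v) (e : Basis ι ℝ E)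
    (he : ∀ i j, G x (e i) (e j) = if i = j then 1 else 0) {Φ : E → ℝ} {c c₁ K κ Φ₀ : ℝ}
    (hc : 1 ≤ c) (hc₁ : c ≤ c₁)
    (heq : ∀ y ∈ V, 1 / 2 * (c * mtrAt G y (W y) ^ 2 - pairAt G y (W y) (W y)) = Φ y)
    (hΦ₀ : 0 < Φ₀) (hΦ : Φ₀ ≤ Φ x) (hw : 0 < mtrAt G x (W x))
    (hmax : IsLocalMax (fun y ↦ lapAt G f y + gradSqAt G f y) x)
    (hn : 2 ≤ Fintype.card ι) (hκ : 1 ≤ κ) (heκ : ∀ a, ‖e a‖ ≤ κ) (hK : 1 ≤ K)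
    (hγ : gradSqAt G f x ≤ K ^ 2)
    (hB1 : ∀ X Y U, |cov₂At G Bf x X Y U| ≤ K * ‖X‖ * ‖Y‖ * ‖U‖)
    (hB2 : ∀ X Y U U', |cov₃At G (cov₂At G Bf) x X Y U U'| ≤ K * ‖X‖ * ‖Y‖ * ‖U‖ * ‖U'‖)
    (hR : ∀ X Y U U', |G x (riemAt G x X Y U) U'| ≤ K * ‖X‖ * ‖Y‖ * ‖U‖ * ‖U'‖)
    (hDR : ∀ X Y U U' U'', |G x (covRiemAt G x X Y U U') U''| ≤
      K * ‖X‖ * ‖Y‖ * ‖U‖ * ‖U'‖ * ‖U''‖)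
    (hΦ1 : ∀ X, |fderiv ℝ Φ x X| ≤ K * ‖X‖) (hΦ2 : |lapAt G Φ x| ≤ K * (1 + |lapAt G f x|)) :
    normSqAt G x (hessAt G f x) ≤
      2 * (((K * κ ^ 5) + (Fintype.card ι : ℝ) * (K * κ ^ 5) ^ 2 / (2 * Φ₀) + 2 * (Fintype.card ι : ℝ) * (K * κ ^ 5) ^ 2) * ((1 + c₁ / (2 * Φ₀)) / 2) + 19 * c₁ * (Fintype.card ι : ℝ) ^ 4 * (K * κ ^ 5) ^ 3)
      + (Fintype.card ι : ℝ) ^ 2 * ((K * κ ^ 5) * ((1 + c₁ / (2 * Φ₀)) / 2) + 24 * c₁ * (Fintype.card ι : ℝ) ^ 3 * (K * κ ^ 5) ^ 2) ^ 2 := by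
  have hK0 : 0 ≤ K := by linarith only [hK]
  have hκ0 : 0 ≤ κ := by linarith only [hκ]
  have key : ∀ (t : ℝ) (m : ℕ), t ≤ K * κ ^ m → m ≤ 5 → t ≤ K * κ ^ 5 := fun t m ht hm ↦
    ht.trans (mul_le_mul_of_nonneg_left (pow_le_pow_right₀ hκ hm) hK0)
  have hK' : 1 ≤ K * κ ^ 5 := one_le_mul_of_one_le_of_one_le hK (one_le_pow₀ hκ)
  have hγ' : gradSqAt G f x ≤ (K * κ ^ 5) ^ 2 :=
    hγ.trans (pow_le_pow_left₀ hK0 (le_mul_of_one_le_right hK0 (one_le_pow₀ hκ)) 2)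
  refine hG.normSqAt_hessAt_le_of_isLocalMax hx hf hB hBs hW hpos e he hc hc₁ heq hΦ₀ hΦ hw hmax hn
    hK' hγ' ?_ ?_ ?_ ?_ ?_ (hΦ2.trans (mul_le_mul_of_nonneg_right
      (le_mul_of_one_le_right hK0 (one_le_pow₀ hκ)) (by positivity)))
  · intro a b c'
    refine key _ 3 ((hB1 _ _ _).trans ?_) (by norm_num)
    calc K * ‖e a‖ * ‖e b‖ * ‖e c'‖ ≤ K * κ * κ * κ := by gcongr <;> exact heκ _
      _ = K * κ ^ 3 := by ring
  · intro a b c' d'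
    refine key _ 4 ((hB2 _ _ _ _).trans ?_) (by norm_num)
    calc K * ‖e a‖ * ‖e b‖ * ‖e c'‖ * ‖e d'‖ ≤ K * κ * κ * κ * κ := by gcongr <;> exact heκ _
      _ = K * κ ^ 4 := by ring
  · intro a b c' d'
    refine key _ 4 ((hR _ _ _ _).trans ?_) (by norm_num)
    calc K * ‖e a‖ * ‖e b‖ * ‖e c'‖ * ‖e d'‖ ≤ K * κ * κ * κ * κ := by gcongr <;> exact heκ _
      _ = K * κ ^ 4 := by ring
  · intro a b c' d' m
    refine key _ 5 ((hDR _ _ _ _ _).trans ?_) le_rfl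
    calc K * ‖e a‖ * ‖e b‖ * ‖e c'‖ * ‖e d'‖ * ‖e m‖ ≤ K * κ * κ * κ * κ * κ := by
          gcongr <;> exact heκ _
      _ = K * κ ^ 5 := by ring
  · intro a
    refine key _ 1 ((hΦ1 _).trans ?_) (by norm_num)
    calc K * ‖e a‖ ≤ K * κ := by gcongr; exact heκ _
      _ = K * κ ^ 1 := by ring

end MetricCoord

end Literature.Geometry.Lorentzian

end
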